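import Mathlib.Analysis.Complex.ExponentialBounds
import Literature.Analysis.FluidPDE.TaoCarlemanSecondCore
import HarnessLib

/-!
# Tao 2021, Prop. 4.3: the second Carleman inequality (backwards uniqueness and unique continuation)

Analysis/FluidPDE proof file (theorems only, no definitions, no named facts), part of the
formalisation of §4 of T. Tao, *Quantitative bounds for critically bounded solutions to the
Navier–Stokes equations*, arXiv:1908.04958v2 (2021), towards the named fact
`Literature.Analysis.FluidPDE.tao_quantitative_ess` (Thm. 1.2).

**Prop. 4.3** (p. 32). Let `u : [0, T] × {|x| ≤ r} → F` be smooth with `Lu = ∂ₜu + Δu` obeying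
(4.4) `|Lu| ≤ C₀⁻¹T⁻¹|u| + C₀^{-1/2}T^{-1/2}|∇u|`, `r² ≥ 4000 T`, `0 < t₁ ≤ t₀ ≤ T/1000`. Then
`∫_{t₀}^{2t₀} ∫_{|x|≤r/2} (T⁻¹|u|² + |∇u|²) e^{−|x|²/4t}
   ≲ e^{−r²/500t₀} X + t₀^{3/2} (e t₀/t₁)^{O(r²/t₀)} Y`,
`X = ∫₀ᵀ∫_{|x|≤r} (T⁻¹|u|² + |∇u|²)`, `Y = ∫_{|x|≤r} |u(0,x)|² t₁^{-3/2} e^{−|x|²/4t₁}`.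

`TaoCarleman.second_carleman_inequality` below is this statement for fields with values in a
real inner-product space `F` over a Euclidean space `E` of dimension `d ≤ 3` (`t₀^{3/2}`,
`t₁^{-3/2}` become `t₀^{d/2}`, `t₁^{-d/2}`), with `C₀ = 1` in (4.4) (a weaker hypothesis than
Tao's large `C₀`), `|∇u|` the operator norm of the slice derivative, open balls, and the implied
constants rendered as one explicit `K` depending only on `E`:
right-hand side `K (e^{−r²/(500 t₀)} X + t₀^{d/2} exp(K (r²/t₀) log(e t₀/t₁)) Y)`.
The time window is `t₀ ≤ T/8000` instead of Tao's `T/1000` (Tao: "the constants … are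
unlikely to be optimal", Remark 1.4; §5 applies the proposition with `t₀` a small multiple of
`T`, after shrinking `T` harmlessly): with the pigeonholed `T₀ ∈ [T/200, T/100]` (4.13) and
`α = r²/(400 t₀)` this makes the Gaussian factor `(3 t₀/(T₀+t₁))^α e^α ≤ e^{−α}` at the upper
time boundary genuinely small, which the printed window does not literally guarantee.

Proof: `TaoCarlemanSecondCore.core_second_carleman` (Lemma 4.1 with the weight (4.14),
integrating factor, absorption), the pigeonhole choice of `T₀`, and the elementary bounds on
the weight `eᵍ` on `[t₀, 2t₀] × E` (from below), on the shell `r/2 ≤ |x| ≤ r`, at `t = T₀` and at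
`t = 0` (from above), pp. 34–35.

## References

* T. Tao, arXiv:1908.04958v2 (2021), §4, Prop. 4.3, pp. 32–35. [Tao2021QuantitativeNS]
-/

noncomputable section

open MeasureTheory Set Function Filter Topology Metric
open scoped InnerProductSpace RealInnerProductSpace Laplacian

namespace Literature.Analysis.FluidPDE

namespace TaoCarleman

open Carleman

/-! ### Elementary inequalities -/

section Elementary

/-- `−a/s − b log s ≤ b log(b/a) − b` for `a, b, s > 0` (the maximum of the left side is at
`s = a/b`; from `log z ≤ z − 1`). [folklore] -/
theorem neg_div_sub_mul_log_le {a b s : ℝ} (ha : 0 < a) (hb : 0 < b) (hs : 0 < s) :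
    -a / s - b * Real.log s ≤ b * Real.log (b / a) - b := by
  have hz : 0 < a / (b * s) := by positivity
  have h1 := Real.log_le_sub_one_of_pos hz
  rw [Real.log_div ha.ne' (by positivity), Real.log_mul hb.ne' hs.ne'] at h1
  rw [Real.log_div hb.ne' ha.ne']
  have h2 := mul_le_mul_of_nonneg_left h1 hb.le
  have h3 : b * (a / (b * s) - 1) = a / s - b := by field_simp
  rw [h3] at h2
  have : -a / s = -(a / s) := by ring
  nlinarith [h2]

/-- `log x ≤ x/100 + 99` for `x > 0` (from `log z ≤ z − 1`). [folklore] -/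
theorem log_le_div_hundred {x : ℝ} (hx : 0 < x) : Real.log x ≤ x / 100 + 99 := by
  have h1 := Real.log_le_sub_one_of_pos (by positivity : (0 : ℝ) < x / 100)
  have h2 := Real.log_le_sub_one_of_pos (by norm_num : (0 : ℝ) < 100)
  rw [Real.log_div hx.ne' (by norm_num)] at h1
  linarith

/-- `x ≤ exp(x/100 + 99)` for `x > 0`. [folklore] -/
theorem le_exp_div_hundred {x : ℝ} (hx : 0 < x) : x ≤ Real.exp (x / 100 + 99) := by
  have := log_le_div_hundred hx
  rwa [Real.log_le_iff_le_exp hx] at this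

/-- `e² < 7.4`. [folklore] -/
theorem exp_two_lt : Real.exp 2 < 7.4 := by
  have h := Real.exp_one_lt_d9
  have h0 := (Real.exp_pos 1).le
  rw [show (2 : ℝ) = 1 + 1 by norm_num, Real.exp_add]
  nlinarith

/-- If `0 < y` and `7.4 y ≤ 1` then `log y ≤ −2`. [folklore] -/
theorem log_le_neg_two {y : ℝ} (hy : 0 < y) (h : 7.4 * y ≤ 1) : Real.log y ≤ -2 := by
  rw [Real.log_le_iff_le_exp hy, Real.exp_neg, le_inv_comm₀ hy (Real.exp_pos 2)]
  calc Real.exp 2 ≤ 7.4 := exp_two_lt.le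
    _ ≤ y⁻¹ := by
        rw [le_inv_comm₀ (by norm_num) hy, inv_eq_one_div, le_div_iff₀ (by norm_num)]
        linarith

/-- **`X`-coefficient bookkeeping**: with `0 < P ≤ α` and an exponent `e ≤ −α`,
`c P eᵉ ≤ c e⁹⁹ e^{−0.8 α}`. [folklore] -/
theorem coeffX_le {c P e α : ℝ} (hc : 0 ≤ c) (hP : 0 < P) (hPα : P ≤ α) (he : e ≤ -α) :
    c * P * Real.exp e ≤ c * Real.exp 99 * Real.exp (-(8 / 10) * α) := by
  have h1 : P ≤ Real.exp (α / 100 + 99) :=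
    (le_exp_div_hundred hP).trans (Real.exp_le_exp.2 (by linarith))
  have h2 : P * Real.exp e ≤ Real.exp (α / 100 + 99) * Real.exp (-α) :=
    mul_le_mul h1 (Real.exp_le_exp.2 he) (Real.exp_pos _).le (Real.exp_pos _).le
  have h3 : Real.exp (α / 100 + 99) * Real.exp (-α) ≤ Real.exp 99 * Real.exp (-(8 / 10) * α) := by
    rw [← Real.exp_add, ← Real.exp_add]
    exact Real.exp_le_exp.2 (by linarith)
  calc c * P * Real.exp e = c * (P * Real.exp e) := by ring
    _ ≤ c * (Real.exp 99 * Real.exp (-(8 / 10) * α)) := mul_le_mul_of_nonneg_left (h2.trans h3) hc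
    _ = _ := by ring

/-- **`Y`-coefficient bookkeeping**: `11 Q α e^{d₂ log 3 + e} ≤ 11 e³ e^{5 α L}` when
`0 < Q ≤ α`, `0 ≤ d₂ ≤ 3/2`, `e ≤ α (2 + L)`, `1 ≤ L`. [folklore] -/
theorem coeffY_le {Q α d2 e L : ℝ} (hQ : 0 < Q) (hQα : Q ≤ α) (hd0 : 0 ≤ d2) (hd : d2 ≤ 3 / 2)
    (he : e ≤ α * (2 + L)) (hL : 1 ≤ L) :
    11 * Q * α * Real.exp (d2 * Real.log 3 + e) ≤ 11 * Real.exp 3 * Real.exp (5 * α * L) := by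
  have hα : 0 < α := lt_of_lt_of_le hQ hQα
  have hlog3 : Real.log 3 ≤ 2 := by
    have := Real.log_le_sub_one_of_pos (by norm_num : (0 : ℝ) < 3)
    linarith
  have hQ' : Q ≤ Real.exp α := hQα.trans (by linarith [Real.add_one_le_exp α])
  have hα' : α ≤ Real.exp α := by linarith [Real.add_one_le_exp α]
  have h1 : Q * α ≤ Real.exp α * Real.exp α := mul_le_mul hQ' hα' hα.le (Real.exp_pos _).le
  have h2 : Real.exp (d2 * Real.log 3 + e) ≤ Real.exp (3 + α * (2 + L)) :=
    Real.exp_le_exp.2 (by nlinarith [mul_le_mul_of_nonneg_left hlog3 hd0])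
  have h3 : Real.exp α * Real.exp α * Real.exp (3 + α * (2 + L)) ≤ Real.exp 3 * Real.exp (5 * α * L) := by
    rw [← Real.exp_add, ← Real.exp_add, ← Real.exp_add]
    exact Real.exp_le_exp.2 (by nlinarith)
  calc 11 * Q * α * Real.exp (d2 * Real.log 3 + e) = 11 * ((Q * α) * Real.exp (d2 * Real.log 3 + e)) := by ring
    _ ≤ 11 * ((Real.exp α * Real.exp α) * Real.exp (3 + α * (2 + L))) := by
        refine mul_le_mul_of_nonneg_left ?_ (by norm_num)
        exact mul_le_mul h1 h2 (Real.exp_pos _).le (by positivity)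
    _ ≤ 11 * (Real.exp 3 * Real.exp (5 * α * L)) := by
        refine mul_le_mul_of_nonneg_left ?_ (by norm_num)
        simpa [mul_assoc] using h3
    _ = _ := by ring

end Elementary

/-! ### Bounds for the Gaussian Carleman weight -/

section WeightBounds

variable {E : Type*} [NormedAddCommGroup E] [InnerProductSpace ℝ E]

variable {t₁ S α : ℝ} {g : ℝ × E → ℝ}
  (hg : g = fun z : ℝ × E => -‖z.2‖ ^ 2 / (4 * (z.1 + t₁)) -
    (Module.finrank ℝ E : ℝ) / 2 * Real.log (z.1 + t₁) - α * Real.log ((z.1 + t₁) / S) +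
      α * (z.1 + t₁) / S)

include hg

/-- **Lower bound on `[t₀, 2t₀]`** (Tao, p. 34: "In the region `t₀ ≤ t ≤ 2t₀` we have
`eᵍ ≥ (3t₀)^{-3/2} e^{−|x|²/4t} (T₀/3t₀)^α`"): for `0 < t₁ ≤ t₀`, `t₀ ≤ t ≤ 2t₀`, `0 < S`, `0 ≤ α`,
`g(t, x) ≥ −|x|²/(4t) − (d/2) log(3t₀) − α log(3t₀/S)`. [cite: Tao2021QuantitativeNS, Prop. 4.3 (proof, p. 34)] -/
theorem gaussWeight_lower {t₀ t : ℝ} (ht₁ : 0 < t₁) (ht₁₀ : t₁ ≤ t₀) (hS : 0 < S) (hα : 0 ≤ α)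
    (ht : t ∈ Icc t₀ (2 * t₀)) (x : E) :
    -‖x‖ ^ 2 / (4 * t) - (Module.finrank ℝ E : ℝ) / 2 * Real.log (3 * t₀) - α * Real.log (3 * t₀ / S) ≤
      g (t, x) := by
  have ht₀ : 0 < t₀ := lt_of_lt_of_le ht₁ ht₁₀
  have htpos : 0 < t := lt_of_lt_of_le ht₀ ht.1
  have hs : 0 < t + t₁ := by linarith
  have hs3 : t + t₁ ≤ 3 * t₀ := by linarith [ht.2]
  have hd : (0 : ℝ) ≤ (Module.finrank ℝ E : ℝ) / 2 := by positivity
  rw [hg]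
  show _ ≤ -‖x‖ ^ 2 / (4 * (t + t₁)) - (Module.finrank ℝ E : ℝ) / 2 * Real.log (t + t₁) -
    α * Real.log ((t + t₁) / S) + α * (t + t₁) / S
  have e1 : -‖x‖ ^ 2 / (4 * t) ≤ -‖x‖ ^ 2 / (4 * (t + t₁)) := by
    rw [neg_div, neg_div, neg_le_neg_iff]
    exact div_le_div_of_nonneg_left (sq_nonneg _) (by positivity) (by linarith)
  have e2 : Real.log (t + t₁) ≤ Real.log (3 * t₀) := Real.log_le_log hs hs3
  have e3 : Real.log ((t + t₁) / S) ≤ Real.log (3 * t₀ / S) :=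
    Real.log_le_log (by positivity) (div_le_div_of_nonneg_right hs3 hS.le)
  have e4 : 0 ≤ α * (t + t₁) / S := by positivity
  nlinarith [mul_le_mul_of_nonneg_left e2 hd, mul_le_mul_of_nonneg_left e3 hα]

/-- **Upper bound on the shell** (Tao, p. 35: "In the region `r/2 ≤ |x| ≤ r` … the
elementary inequality `x^{-(α+3/2)} e^{−r²/(16x)} ≤ (16(α+3/2)/(e r²))^{α+3/2}`"): for
`0 ≤ t`, `t + t₁ ≤ S`, `0 < t₁`, `0 < α`, `r > 0` and `|x| ≥ r/2`,
`g(t, x) ≤ (α + d/2) log((α + d/2)/(r²/16)) − (α + d/2) + α log S + α`. [cite: Tao2021QuantitativeNS, Prop. 4.3 (proof, p. 35)] -/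
theorem gaussWeight_shell_upper {t r : ℝ} (ht₁ : 0 < t₁) (hα : 0 < α) (hr : 0 < r) (ht : 0 ≤ t)
    (htS : t + t₁ ≤ S) {x : E} (hx : r / 2 ≤ ‖x‖) :
    g (t, x) ≤ (α + (Module.finrank ℝ E : ℝ) / 2) * Real.log ((α + (Module.finrank ℝ E : ℝ) / 2) / (r ^ 2 / 16)) -
      (α + (Module.finrank ℝ E : ℝ) / 2) + α * Real.log S + α := by
  have hs : 0 < t + t₁ := by linarith
  have hS : 0 < S := lt_of_lt_of_le hs htS
  have hd : (0 : ℝ) ≤ (Module.finrank ℝ E : ℝ) / 2 := by positivity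
  set b : ℝ := α + (Module.finrank ℝ E : ℝ) / 2 with hb
  have hbpos : 0 < b := by positivity
  have hkey := neg_div_sub_mul_log_le (a := r ^ 2 / 16) (by positivity) hbpos hs
  rw [hg]
  show -‖x‖ ^ 2 / (4 * (t + t₁)) - (Module.finrank ℝ E : ℝ) / 2 * Real.log (t + t₁) -
    α * Real.log ((t + t₁) / S) + α * (t + t₁) / S ≤ _
  have e1 : -‖x‖ ^ 2 / (4 * (t + t₁)) ≤ -(r ^ 2 / 16) / (t + t₁) := by
    rw [neg_div, neg_div, neg_le_neg_iff, div_le_div_iff₀ hs (by positivity)]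
    have : r ^ 2 / 4 ≤ ‖x‖ ^ 2 := by nlinarith [norm_nonneg x]
    nlinarith
  have e2 : Real.log ((t + t₁) / S) = Real.log (t + t₁) - Real.log S := Real.log_div hs.ne' hS.ne'
  have e3 : α * (t + t₁) / S ≤ α := by
    rw [div_le_iff₀ hS]
    exact mul_le_mul_of_nonneg_left htS hα.le
  rw [e2]
  have key : -(r ^ 2 / 16) / (t + t₁) - b * Real.log (t + t₁) ≤ b * Real.log (b / (r ^ 2 / 16)) - b := hkey
  have hbl : b * Real.log (t + t₁) = α * Real.log (t + t₁) + (Module.finrank ℝ E : ℝ) / 2 * Real.log (t + t₁) := by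
    rw [hb]
    ring
  linarith [e1, key, e3, hbl]

/-- **Upper bound at the top time** `t = T₀`, `S = T₀ + t₁`: `g(T₀, x) ≤ −(d/2) log S + α`
(Tao, p. 35: "When `t = T₀`, we use (4.12) to bound `eᵍ ≤ T₀^{-3/2} e^α`"). [cite: Tao2021QuantitativeNS, Prop. 4.3 (proof, p. 35)] -/
theorem gaussWeight_top_upper {T₀ : ℝ} (hS : S = T₀ + t₁) (hSpos : 0 < S) (x : E) :
    g (T₀, x) ≤ -((Module.finrank ℝ E : ℝ) / 2) * Real.log S + α := by
  rw [hg]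
  show -‖x‖ ^ 2 / (4 * (T₀ + t₁)) - (Module.finrank ℝ E : ℝ) / 2 * Real.log (T₀ + t₁) -
    α * Real.log ((T₀ + t₁) / S) + α * (T₀ + t₁) / S ≤ _
  rw [← hS, div_self hSpos.ne', Real.log_one, mul_zero, sub_zero, mul_div_assoc, div_self hSpos.ne', mul_one]
  have : 0 ≤ ‖x‖ ^ 2 / (4 * S) := by positivity
  have h2 : -‖x‖ ^ 2 / (4 * S) = -(‖x‖ ^ 2 / (4 * S)) := by ring
  linarith

/-- **Upper bound at the bottom time** `t = 0`: `g(0, x) ≤ −|x|²/(4t₁) − (d/2) log t₁ + α log(S/t₁) + α`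
(Tao, p. 35: "When `t = 0`, we have `eᵍ ≤ t₁^{-3/2} e^{−|x|²/4t₁} (T₀/t₁)^α e^{O(r²/t₀)}`"). [cite: Tao2021QuantitativeNS, Prop. 4.3 (proof, p. 35)] -/
theorem gaussWeight_bottom_upper (ht₁ : 0 < t₁) (ht₁S : t₁ ≤ S) (hα : 0 ≤ α) (x : E) :
    g (0, x) ≤ -‖x‖ ^ 2 / (4 * t₁) - (Module.finrank ℝ E : ℝ) / 2 * Real.log t₁ + α * Real.log (S / t₁) + α := by
  have hS : 0 < S := lt_of_lt_of_le ht₁ ht₁S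
  rw [hg]
  show -‖x‖ ^ 2 / (4 * (0 + t₁)) - (Module.finrank ℝ E : ℝ) / 2 * Real.log (0 + t₁) -
    α * Real.log ((0 + t₁) / S) + α * (0 + t₁) / S ≤ _
  rw [zero_add]
  have e1 : Real.log (t₁ / S) = -Real.log (S / t₁) := by
    rw [Real.log_div ht₁.ne' hS.ne', Real.log_div hS.ne' ht₁.ne']
    ring
  have e2 : α * t₁ / S ≤ α := by
    rw [div_le_iff₀ hS]
    exact mul_le_mul_of_nonneg_left ht₁S hα
  rw [e1]
  linarith

end WeightBounds

/-! ### The four terms of the core inequality against `X`, `Y` and the left-hand side -/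

section Terms

variable {E : Type*} [NormedAddCommGroup E] [InnerProductSpace ℝ E] [FiniteDimensional ℝ E]
  [MeasurableSpace E] [BorelSpace E]
variable {F : Type*} [NormedAddCommGroup F] [InnerProductSpace ℝ F]

variable {T r t₀ t₁ T₀ S α Cψ : ℝ} {u : ℝ → E → F} {g : ℝ × E → ℝ} {GS : ℝ × E → ℝ} {φ : ℝ → ℝ}
variable (hT : 0 < T) (hr : 0 < r) (ht₁ : 0 < t₁) (hT₀ : 0 < T₀) (hT₀T : T₀ < T) (hS : S = T₀ + t₁)
  (hu : ContDiffOn ℝ 2 (uncurry u) (Icc 0 T ×ˢ univ))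
  (hGS : GS = fun z : ℝ × E => ∑ i, ‖fderiv ℝ (u z.1) z.2 (stdOrthonormalBasis ℝ E i)‖ ^ 2)
  (hg : g = fun z : ℝ × E => -‖z.2‖ ^ 2 / (4 * (z.1 + t₁)) -
    (Module.finrank ℝ E : ℝ) / 2 * Real.log (z.1 + t₁) - α * Real.log ((z.1 + t₁) / S) +
      α * (z.1 + t₁) / S)
  (hφ : φ = fun t => ∫ x in ball (0 : E) r, (T⁻¹ * ‖u t x‖ ^ 2 + ‖fderiv ℝ (u t) x‖ ^ 2))

include hT hu hφ in
/-- `φ(t) = ∫_{|x|<r} (T⁻¹|u|² + |∇u|²)(t, x) dx` is continuous on `[0, T]` and nonnegative. [folklore] -/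
theorem continuousOn_phi : ContinuousOn φ (Icc 0 T) ∧ ∀ t, 0 ≤ φ t := by
  rw [hφ]
  refine ⟨?_, fun t => integral_nonneg fun x => by positivity⟩
  have c : ContinuousOn (fun z : ℝ × E => T⁻¹ * ‖u z.1 z.2‖ ^ 2 + ‖fderiv ℝ (u z.1) z.2‖ ^ 2) (Icc 0 T ×ˢ univ) :=
    (continuousOn_const.mul ((hu.continuousOn.norm).pow 2)).add (continuousOn_norm_sliceFDeriv_sq hT hu (by norm_num))
  exact continuousOn_setIntegral_slice measurableSet_ball isBounded_ball (c.mono (prod_mono Subset.rfl (subset_univ _)))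

include hGS in
omit [MeasurableSpace E] [BorelSpace E] in
/-- `‖D(u t)(x)‖² ≤ GS(t,x) ≤ d ‖D(u t)(x)‖²`, and `GS ≥ 0`. [folklore] -/
theorem GS_compare (z : ℝ × E) :
    ‖fderiv ℝ (u z.1) z.2‖ ^ 2 ≤ GS z ∧ GS z ≤ (Module.finrank ℝ E : ℝ) * ‖fderiv ℝ (u z.1) z.2‖ ^ 2 ∧ 0 ≤ GS z := by
  rw [hGS]
  exact ⟨opNorm_sq_le_sum_sq _, sum_sq_le_finrank_mul_opNorm_sq _, Finset.sum_nonneg fun i _ => sq_nonneg _⟩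

include hT ht₁ hT₀ hT₀T hS hu hGS hg in
/-- **Left-hand side**: on `t ∈ [t₀, 2t₀]` (with `0 < t₁ ≤ t₀`, `2t₀ ≤ T₀`, `t₀ T⁻¹ ≤ (9/2) α`),
`(t₀/(10S)) e^{c₁} ∫_{|x|<r/2} (T⁻¹|u|² + |∇u|²) e^{−|x|²/4t} ≤ I_in(t)`,
`c₁ = −(d/2) log(3t₀) − α log(3t₀/S)`. [cite: Tao2021QuantitativeNS, Prop. 4.3 (proof, p. 34)] -/
theorem Iin_lower (ht₁₀ : t₁ ≤ t₀) (h2t₀ : 2 * t₀ ≤ T₀) (hα : 0 ≤ α) (hαT : t₀ * T⁻¹ ≤ 9 / 2 * α)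
    {t : ℝ} (ht : t ∈ Icc t₀ (2 * t₀)) :
    t₀ / (10 * S) * Real.exp (-((Module.finrank ℝ E : ℝ) / 2) * Real.log (3 * t₀) - α * Real.log (3 * t₀ / S)) *
        ∫ x in ball (0 : E) (r / 2), (T⁻¹ * ‖u t x‖ ^ 2 + ‖fderiv ℝ (u t) x‖ ^ 2) *
          Real.exp (-‖x‖ ^ 2 / (4 * t)) ≤
      ∫ x in ball (0 : E) (r / 2), ((t + t₁) / (10 * S) * GS (t, x) + 9 * α / (20 * S) * ‖u t x‖ ^ 2) *
        Real.exp (g (t, x)) := by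
  have hSpos : 0 < S := by rw [hS]; linarith
  have ht₀ : 0 < t₀ := lt_of_lt_of_le ht₁ ht₁₀
  have htpos : 0 < t := lt_of_lt_of_le ht₀ ht.1
  have htc : t ∈ Icc 0 T := ⟨htpos.le, by linarith [ht.2, hT₀T]⟩
  have hslab : ∀ x : E, ((t, x) : ℝ × E) ∈ Icc 0 T ×ˢ (univ : Set E) := fun x => mk_mem_prod htc (mem_univ x)
  rw [← integral_const_mul]
  have cw := continuousOn_exp_gaussWeight_slab (E := E) (T := T) ht₁ hT₀ hS hg
  have cGS := continuousOn_GS_slab hT hu hGS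
  have cu : ContinuousOn (fun z : ℝ × E => ‖u z.1 z.2‖ ^ 2) (Icc 0 T ×ˢ univ) := (hu.continuousOn.norm).pow 2
  have cG := continuousOn_norm_sliceFDeriv_sq hT hu (by norm_num : (1 : WithTop ℕ∞) ≤ 2)
  have cgauss : Continuous fun x : E => Real.exp (-‖x‖ ^ 2 / (4 * t)) :=
    Real.continuous_exp.comp (((continuous_norm.pow 2).neg).div_const _)
  have i1 : IntegrableOn (fun x : E => t₀ / (10 * S) *
      Real.exp (-((Module.finrank ℝ E : ℝ) / 2) * Real.log (3 * t₀) - α * Real.log (3 * t₀ / S)) *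
        ((T⁻¹ * ‖u t x‖ ^ 2 + ‖fderiv ℝ (u t) x‖ ^ 2) * Real.exp (-‖x‖ ^ 2 / (4 * t)))) (ball (0 : E) (r / 2)) := by
    have c1 : Continuous fun x : E => T⁻¹ * ‖u t x‖ ^ 2 + ‖fderiv ℝ (u t) x‖ ^ 2 :=
      continuous_slice ((continuousOn_const.mul cu).add cG) hslab
    exact (((continuous_const.mul (c1.mul cgauss))).continuousOn.integrableOn_compact
      (isCompact_closedBall (0 : E) (r / 2))).mono_set ball_subset_closedBall
  have i2 : IntegrableOn (fun x : E => ((t + t₁) / (10 * S) * GS (t, x) + 9 * α / (20 * S) * ‖u t x‖ ^ 2) *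
      Real.exp (g (t, x))) (ball (0 : E) (r / 2)) :=
    integrableOn_slab_slice (Φ := fun z : ℝ × E => ((z.1 + t₁) / (10 * S) * GS z + 9 * α / (20 * S) *
      ‖u z.1 z.2‖ ^ 2) * Real.exp (g z))
      (((((continuous_fst.add continuous_const).div_const _).continuousOn.mul cGS).add
        (continuousOn_const.mul cu)).mul cw) htc isBounded_ball
  refine setIntegral_mono_on i1 i2 measurableSet_ball fun x _ => ?_
  obtain ⟨hGop, -, hGS0⟩ := GS_compare hGS (t, x)
  have hlow := gaussWeight_lower hg ht₁ ht₁₀ hSpos hα ht x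
  have hexp : Real.exp (-((Module.finrank ℝ E : ℝ) / 2) * Real.log (3 * t₀) - α * Real.log (3 * t₀ / S)) *
      Real.exp (-‖x‖ ^ 2 / (4 * t)) ≤ Real.exp (g (t, x)) := by
    rw [← Real.exp_add]
    exact Real.exp_le_exp.2 (by linarith)
  have hA : t₀ / (10 * S) * (T⁻¹ * ‖u t x‖ ^ 2 + ‖fderiv ℝ (u t) x‖ ^ 2) ≤
      (t + t₁) / (10 * S) * GS (t, x) + 9 * α / (20 * S) * ‖u t x‖ ^ 2 := by
    have e1 : t₀ / (10 * S) * ‖fderiv ℝ (u t) x‖ ^ 2 ≤ (t + t₁) / (10 * S) * GS (t, x) := by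
      have : t₀ / (10 * S) ≤ (t + t₁) / (10 * S) :=
        div_le_div_of_nonneg_right (by linarith [ht.1]) (by positivity)
      exact mul_le_mul this hGop (sq_nonneg _) (by positivity)
    have e2 : t₀ / (10 * S) * (T⁻¹ * ‖u t x‖ ^ 2) ≤ 9 * α / (20 * S) * ‖u t x‖ ^ 2 := by
      have : t₀ / (10 * S) * T⁻¹ ≤ 9 * α / (20 * S) := by
        rw [div_mul_eq_mul_div, div_le_div_iff₀ (by positivity) (by positivity)]
        nlinarith [hSpos]
      calc t₀ / (10 * S) * (T⁻¹ * ‖u t x‖ ^ 2) = t₀ / (10 * S) * T⁻¹ * ‖u t x‖ ^ 2 := by ring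
        _ ≤ 9 * α / (20 * S) * ‖u t x‖ ^ 2 := mul_le_mul_of_nonneg_right this (sq_nonneg _)
    nlinarith [e1, e2]
  have hApos : 0 ≤ t₀ / (10 * S) * (T⁻¹ * ‖u t x‖ ^ 2 + ‖fderiv ℝ (u t) x‖ ^ 2) := by positivity
  calc t₀ / (10 * S) * Real.exp (-((Module.finrank ℝ E : ℝ) / 2) * Real.log (3 * t₀) - α * Real.log (3 * t₀ / S)) *
        ((T⁻¹ * ‖u t x‖ ^ 2 + ‖fderiv ℝ (u t) x‖ ^ 2) * Real.exp (-‖x‖ ^ 2 / (4 * t)))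
      = (t₀ / (10 * S) * (T⁻¹ * ‖u t x‖ ^ 2 + ‖fderiv ℝ (u t) x‖ ^ 2)) *
          (Real.exp (-((Module.finrank ℝ E : ℝ) / 2) * Real.log (3 * t₀) - α * Real.log (3 * t₀ / S)) *
            Real.exp (-‖x‖ ^ 2 / (4 * t))) := by ring
    _ ≤ ((t + t₁) / (10 * S) * GS (t, x) + 9 * α / (20 * S) * ‖u t x‖ ^ 2) * Real.exp (g (t, x)) :=
        mul_le_mul hA hexp (by positivity) (by
          have : 0 ≤ t + t₁ := by linarith
          positivity)

include hT hr ht₁ hT₀ hT₀T hS hu hGS hg hφ in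
/-- **Shell term**: for `t ∈ [0, T₀]`, `d ≤ 3`, `0 < α`,
`m(t) P_sh(t) ≤ (33/10) S · C_sh e^{c₂} · 3T⁻¹ · φ(t)`, `c₂ = b log(b/(r²/16)) − b + α log S + α`,
`b = α + d/2`. [cite: Tao2021QuantitativeNS, Prop. 4.3 (proof, p. 35)] -/
theorem m_Psh_le (hd3 : Module.finrank ℝ E ≤ 3) (hα : 0 < α) (hCψ : 0 ≤ Cψ) {t : ℝ} (ht : t ∈ Icc 0 T₀) :
    ((t + t₁) + (t + t₁) ^ 2 / (10 * S)) *
        ∫ x in ball (0 : E) r \ ball 0 (r / 2),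
          4 * (2 + Cψ ^ 2 + 4 * Cψ) * (T⁻¹ ^ 2 * ‖u t x‖ ^ 2 + T⁻¹ * GS (t, x)) * Real.exp (g (t, x)) ≤
      33 / 10 * S * (4 * (2 + Cψ ^ 2 + 4 * Cψ) * Real.exp ((α + (Module.finrank ℝ E : ℝ) / 2) *
        Real.log ((α + (Module.finrank ℝ E : ℝ) / 2) / (r ^ 2 / 16)) - (α + (Module.finrank ℝ E : ℝ) / 2) +
          α * Real.log S + α) * (3 * T⁻¹)) * φ t := by
  have hSpos : 0 < S := by rw [hS]; linarith
  have htc : t ∈ Icc 0 T := ⟨ht.1, ht.2.trans hT₀T.le⟩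
  have hsS : t + t₁ ≤ S := by rw [hS]; linarith [ht.2]
  have hs0 : 0 ≤ t + t₁ := by linarith [ht.1]
  have hd3' : (Module.finrank ℝ E : ℝ) ≤ 3 := by exact_mod_cast hd3
  set Csh : ℝ := 4 * (2 + Cψ ^ 2 + 4 * Cψ) with hCsh
  have hCsh0 : 0 ≤ Csh := by rw [hCsh]; positivity
  set c₂ : ℝ := (α + (Module.finrank ℝ E : ℝ) / 2) * Real.log ((α + (Module.finrank ℝ E : ℝ) / 2) / (r ^ 2 / 16)) -
    (α + (Module.finrank ℝ E : ℝ) / 2) + α * Real.log S + α with hc₂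
  -- `m ≤ 1.1 S`
  have hmle : (t + t₁) + (t + t₁) ^ 2 / (10 * S) ≤ 11 / 10 * S := by
    have : (t + t₁) ^ 2 / (10 * S) ≤ (t + t₁) / 10 := by
      rw [div_le_iff₀ (by positivity)]
      nlinarith
    linarith
  have hmnn : 0 ≤ (t + t₁) + (t + t₁) ^ 2 / (10 * S) := by positivity
  -- `P_sh ≤ C_sh e^{c₂} 3T⁻¹ φ`
  have cw := continuousOn_exp_gaussWeight_slab (E := E) (T := T) ht₁ hT₀ hS hg
  have cGS := continuousOn_GS_slab hT hu hGS
  have cu : ContinuousOn (fun z : ℝ × E => ‖u z.1 z.2‖ ^ 2) (Icc 0 T ×ˢ univ) := (hu.continuousOn.norm).pow 2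
  have cG := continuousOn_norm_sliceFDeriv_sq hT hu (by norm_num : (1 : WithTop ℕ∞) ≤ 2)
  have iMaj : IntegrableOn (fun x : E => Csh * Real.exp c₂ * (3 * T⁻¹) * (T⁻¹ * ‖u t x‖ ^ 2 + ‖fderiv ℝ (u t) x‖ ^ 2))
      (ball (0 : E) r) :=
    integrableOn_slab_slice (Φ := fun z : ℝ × E => Csh * Real.exp c₂ * (3 * T⁻¹) *
      (T⁻¹ * ‖u z.1 z.2‖ ^ 2 + ‖fderiv ℝ (u z.1) z.2‖ ^ 2)) (continuousOn_const.mul ((continuousOn_const.mul cu).add cG))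
      htc isBounded_ball
  have iP : IntegrableOn (fun x : E => Csh * (T⁻¹ ^ 2 * ‖u t x‖ ^ 2 + T⁻¹ * GS (t, x)) * Real.exp (g (t, x)))
      (ball (0 : E) r \ ball 0 (r / 2)) :=
    integrableOn_slab_slice (Φ := fun z : ℝ × E => Csh * (T⁻¹ ^ 2 * ‖u z.1 z.2‖ ^ 2 + T⁻¹ * GS z) * Real.exp (g z))
      ((continuousOn_const.mul ((continuousOn_const.mul cu).add (continuousOn_const.mul cGS))).mul cw) htc
      (isBounded_ball.subset Set.sdiff_subset)
  have hP1 : ∫ x in ball (0 : E) r \ ball 0 (r / 2), Csh * (T⁻¹ ^ 2 * ‖u t x‖ ^ 2 + T⁻¹ * GS (t, x)) *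
      Real.exp (g (t, x)) ≤ ∫ x in ball (0 : E) r \ ball 0 (r / 2),
        Csh * Real.exp c₂ * (3 * T⁻¹) * (T⁻¹ * ‖u t x‖ ^ 2 + ‖fderiv ℝ (u t) x‖ ^ 2) := by
    refine setIntegral_mono_on iP (iMaj.mono_set Set.sdiff_subset) (measurableSet_ball.diff measurableSet_ball)
      fun x hx => ?_
    have hxr : r / 2 ≤ ‖x‖ := by
      have := hx.2
      rwa [mem_ball, dist_zero_right, not_lt] at this
    obtain ⟨-, hGSd, hGS0⟩ := GS_compare hGS (t, x)
    have hgle := gaussWeight_shell_upper hg ht₁ hα hr ht.1 hsS hxr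
    have hexp : Real.exp (g (t, x)) ≤ Real.exp c₂ := Real.exp_le_exp.2 hgle
    have hB : T⁻¹ ^ 2 * ‖u t x‖ ^ 2 + T⁻¹ * GS (t, x) ≤ 3 * T⁻¹ * (T⁻¹ * ‖u t x‖ ^ 2 + ‖fderiv ℝ (u t) x‖ ^ 2) := by
      have hT0 : 0 ≤ T⁻¹ := inv_nonneg.2 hT.le
      have h3 : GS (t, x) ≤ 3 * ‖fderiv ℝ (u t) x‖ ^ 2 :=
        hGSd.trans (mul_le_mul_of_nonneg_right hd3' (sq_nonneg _))
      nlinarith [mul_le_mul_of_nonneg_left h3 hT0, mul_nonneg hT0 (mul_nonneg hT0 (sq_nonneg ‖u t x‖))]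
    have hBnn : 0 ≤ T⁻¹ ^ 2 * ‖u t x‖ ^ 2 + T⁻¹ * GS (t, x) := by positivity
    calc Csh * (T⁻¹ ^ 2 * ‖u t x‖ ^ 2 + T⁻¹ * GS (t, x)) * Real.exp (g (t, x))
        ≤ Csh * (3 * T⁻¹ * (T⁻¹ * ‖u t x‖ ^ 2 + ‖fderiv ℝ (u t) x‖ ^ 2)) * Real.exp c₂ :=
          mul_le_mul (mul_le_mul_of_nonneg_left hB hCsh0) hexp (Real.exp_pos _).le (by positivity)
      _ = _ := by ring
  have hP2 : ∫ x in ball (0 : E) r \ ball 0 (r / 2),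
      Csh * Real.exp c₂ * (3 * T⁻¹) * (T⁻¹ * ‖u t x‖ ^ 2 + ‖fderiv ℝ (u t) x‖ ^ 2) ≤
      ∫ x in ball (0 : E) r, Csh * Real.exp c₂ * (3 * T⁻¹) * (T⁻¹ * ‖u t x‖ ^ 2 + ‖fderiv ℝ (u t) x‖ ^ 2) :=
    setIntegral_mono_set iMaj (Eventually.of_forall fun x => by positivity) (Eventually.of_forall Set.sdiff_subset)
  have hP3 : ∫ x in ball (0 : E) r, Csh * Real.exp c₂ * (3 * T⁻¹) * (T⁻¹ * ‖u t x‖ ^ 2 + ‖fderiv ℝ (u t) x‖ ^ 2) =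
      Csh * Real.exp c₂ * (3 * T⁻¹) * φ t := by
    rw [hφ, ← integral_const_mul]
  have hφ0 : 0 ≤ φ t := (continuousOn_phi hT hu hφ).2 t
  calc ((t + t₁) + (t + t₁) ^ 2 / (10 * S)) * ∫ x in ball (0 : E) r \ ball 0 (r / 2),
        Csh * (T⁻¹ ^ 2 * ‖u t x‖ ^ 2 + T⁻¹ * GS (t, x)) * Real.exp (g (t, x))
      ≤ (11 / 10 * S) * (Csh * Real.exp c₂ * (3 * T⁻¹) * φ t) := by
        refine mul_le_mul hmle ((hP1.trans hP2).trans hP3.le) ?_ (by positivity)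
        exact integral_nonneg fun x => by
          have := (GS_compare hGS (t, x)).2.2
          positivity
    _ ≤ 33 / 10 * S * (Csh * Real.exp c₂ * (3 * T⁻¹)) * φ t := by
        have : 0 ≤ S * (Csh * Real.exp c₂ * (3 * T⁻¹)) * φ t := by positivity
        nlinarith

include hT hr ht₁ hT₀ hT₀T hS hu hGS hg hφ in
/-- **Top term**: `∫_{|x|<r} (2 GS + 2(C/r²)|u|²)(T₀) eᵍ ≤ e^{c₃} (6 + C) φ(T₀)`, `c₃ = −(d/2) log S + α`,
for `d ≤ 3` and `2T ≤ r²`. [cite: Tao2021QuantitativeNS, Prop. 4.3 (proof, p. 35)] -/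
theorem top_le (hd3 : Module.finrank ℝ E ≤ 3) (hCψ : 0 ≤ Cψ) (hrT : 2 * T ≤ r ^ 2) :
    ∫ x in ball (0 : E) r, (2 * GS (T₀, x) + 2 * (Cψ / r ^ 2) * ‖u T₀ x‖ ^ 2) * Real.exp (g (T₀, x)) ≤
      Real.exp (-((Module.finrank ℝ E : ℝ) / 2) * Real.log S + α) * (6 + Cψ) * φ T₀ := by
  have hSpos : 0 < S := by rw [hS]; linarith
  have hT₀c : T₀ ∈ Icc 0 T := ⟨hT₀.le, hT₀T.le⟩
  have hd3' : (Module.finrank ℝ E : ℝ) ≤ 3 := by exact_mod_cast hd3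
  have hr2 : 0 < r ^ 2 := by positivity
  have cw := continuousOn_exp_gaussWeight_slab (E := E) (T := T) ht₁ hT₀ hS hg
  have cGS := continuousOn_GS_slab hT hu hGS
  have cu : ContinuousOn (fun z : ℝ × E => ‖u z.1 z.2‖ ^ 2) (Icc 0 T ×ˢ univ) := (hu.continuousOn.norm).pow 2
  have cG := continuousOn_norm_sliceFDeriv_sq hT hu (by norm_num : (1 : WithTop ℕ∞) ≤ 2)
  set c₃ : ℝ := -((Module.finrank ℝ E : ℝ) / 2) * Real.log S + α with hc₃
  have iL : IntegrableOn (fun x : E => (2 * GS (T₀, x) + 2 * (Cψ / r ^ 2) * ‖u T₀ x‖ ^ 2) * Real.exp (g (T₀, x)))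
      (ball (0 : E) r) :=
    integrableOn_slab_slice (Φ := fun z : ℝ × E => (2 * GS z + 2 * (Cψ / r ^ 2) * ‖u z.1 z.2‖ ^ 2) *
      Real.exp (g z)) (((continuousOn_const.mul cGS).add (continuousOn_const.mul cu)).mul cw) hT₀c isBounded_ball
  have iR : IntegrableOn (fun x : E => Real.exp c₃ * (6 + Cψ) * (T⁻¹ * ‖u T₀ x‖ ^ 2 + ‖fderiv ℝ (u T₀) x‖ ^ 2))
      (ball (0 : E) r) :=
    integrableOn_slab_slice (Φ := fun z : ℝ × E => Real.exp c₃ * (6 + Cψ) *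
      (T⁻¹ * ‖u z.1 z.2‖ ^ 2 + ‖fderiv ℝ (u z.1) z.2‖ ^ 2)) (continuousOn_const.mul ((continuousOn_const.mul cu).add cG))
      hT₀c isBounded_ball
  have key : ∫ x in ball (0 : E) r, (2 * GS (T₀, x) + 2 * (Cψ / r ^ 2) * ‖u T₀ x‖ ^ 2) * Real.exp (g (T₀, x)) ≤
      ∫ x in ball (0 : E) r, Real.exp c₃ * (6 + Cψ) * (T⁻¹ * ‖u T₀ x‖ ^ 2 + ‖fderiv ℝ (u T₀) x‖ ^ 2) := by
    refine setIntegral_mono_on iL iR measurableSet_ball fun x _ => ?_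
    obtain ⟨-, hGSd, hGS0⟩ := GS_compare hGS (T₀, x)
    have hexp : Real.exp (g (T₀, x)) ≤ Real.exp c₃ := Real.exp_le_exp.2 (gaussWeight_top_upper hg hS hSpos x)
    have hB : 2 * GS (T₀, x) + 2 * (Cψ / r ^ 2) * ‖u T₀ x‖ ^ 2 ≤
        (6 + Cψ) * (T⁻¹ * ‖u T₀ x‖ ^ 2 + ‖fderiv ℝ (u T₀) x‖ ^ 2) := by
      have h1 : 2 * GS (T₀, x) ≤ 6 * ‖fderiv ℝ (u T₀) x‖ ^ 2 := by
        nlinarith [hGSd, mul_le_mul_of_nonneg_right hd3' (sq_nonneg ‖fderiv ℝ (u T₀) x‖)]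
      have h2 : 2 * (Cψ / r ^ 2) ≤ Cψ * T⁻¹ := by
        rw [div_eq_mul_inv, show 2 * (Cψ * (r ^ 2)⁻¹) = Cψ * (2 * (r ^ 2)⁻¹) by ring]
        refine mul_le_mul_of_nonneg_left ?_ hCψ
        rw [← div_eq_mul_inv, div_le_iff₀ hr2, inv_mul_eq_div, le_div_iff₀ hT]
        linarith
      have h3 := mul_le_mul_of_nonneg_right h2 (sq_nonneg ‖u T₀ x‖)
      have hT0 : 0 ≤ T⁻¹ := inv_nonneg.2 hT.le
      nlinarith [h1, h3, mul_nonneg hCψ (sq_nonneg ‖fderiv ℝ (u T₀) x‖),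
        mul_nonneg hT0 (sq_nonneg ‖u T₀ x‖)]
    have hBnn : 0 ≤ 2 * GS (T₀, x) + 2 * (Cψ / r ^ 2) * ‖u T₀ x‖ ^ 2 := by positivity
    calc (2 * GS (T₀, x) + 2 * (Cψ / r ^ 2) * ‖u T₀ x‖ ^ 2) * Real.exp (g (T₀, x))
        ≤ ((6 + Cψ) * (T⁻¹ * ‖u T₀ x‖ ^ 2 + ‖fderiv ℝ (u T₀) x‖ ^ 2)) * Real.exp c₃ :=
          mul_le_mul hB hexp (Real.exp_pos _).le (by positivity)
      _ = _ := by ring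
  refine key.trans (le_of_eq ?_)
  rw [hφ, ← integral_const_mul]

include ht₁ hg in
omit [InnerProductSpace ℝ F] in
/-- **Bottom term**: `∫_{|x|<r} |u(0)|² e^{g(0,·)} ≤ e^{α log(S/t₁) + α} ∫_{|x|<r} |u(0,x)|² t₁^{-d/2} e^{−|x|²/4t₁}`. [cite: Tao2021QuantitativeNS, Prop. 4.3 (proof, p. 35)] -/
theorem bottom_le (ht₁S : t₁ ≤ S) (hα : 0 ≤ α)
    (hint : IntegrableOn (fun x : E => ‖u 0 x‖ ^ 2 * Real.exp (g (0, x))) (ball (0 : E) r))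
    (hint' : IntegrableOn (fun x : E => ‖u 0 x‖ ^ 2 * (t₁ ^ (-(Module.finrank ℝ E : ℝ) / 2) *
      Real.exp (-‖x‖ ^ 2 / (4 * t₁)))) (ball (0 : E) r)) :
    ∫ x in ball (0 : E) r, ‖u 0 x‖ ^ 2 * Real.exp (g (0, x)) ≤
      Real.exp (α * Real.log (S / t₁) + α) *
        ∫ x in ball (0 : E) r, ‖u 0 x‖ ^ 2 * (t₁ ^ (-(Module.finrank ℝ E : ℝ) / 2) * Real.exp (-‖x‖ ^ 2 / (4 * t₁))) := by
  rw [← integral_const_mul]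
  refine setIntegral_mono_on hint (hint'.const_mul _) measurableSet_ball fun x _ => ?_
  have hgle := gaussWeight_bottom_upper hg ht₁ ht₁S hα x
  have hrpow : t₁ ^ (-(Module.finrank ℝ E : ℝ) / 2) = Real.exp (Real.log t₁ * (-(Module.finrank ℝ E : ℝ) / 2)) :=
    Real.rpow_def_of_pos ht₁ _
  have hexp : Real.exp (g (0, x)) ≤ Real.exp (α * Real.log (S / t₁) + α) *
      (t₁ ^ (-(Module.finrank ℝ E : ℝ) / 2) * Real.exp (-‖x‖ ^ 2 / (4 * t₁))) := by
    rw [hrpow, ← Real.exp_add, ← Real.exp_add]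
    exact Real.exp_le_exp.2 (by nlinarith [hgle])
  have := mul_le_mul_of_nonneg_left hexp (sq_nonneg ‖u 0 x‖)
  nlinarith [this]

end Terms

/-! ### The three coefficients (pure real arithmetic) -/

section Coefficients

/-- **Shell coefficient.** [folklore] -/
theorem coef_shell_le {T r t₀ S α d Csh : ℝ} (hT : 0 < T) (hr : 0 < r) (ht₀ : 0 < t₀) (hS : 0 < S)
    (hd0 : 0 ≤ d) (hd3 : d ≤ 3) (hCsh : 0 ≤ Csh) (hα : α = r ^ 2 / (400 * t₀)) (hαpos : 0 < α)
    (hrT : 4000 * T ≤ r ^ 2) (ht₀T : 8000 * t₀ ≤ T) (hP : S ^ 2 / (t₀ * T) ≤ α) :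
    (t₀ / (10 * S) * Real.exp (-(d / 2) * Real.log (3 * t₀) - α * Real.log (3 * t₀ / S)))⁻¹ *
        (33 / 10 * S * (Csh * Real.exp ((α + d / 2) * Real.log ((α + d / 2) / (r ^ 2 / 16)) - (α + d / 2) +
          α * Real.log S + α) * (3 * T⁻¹))) ≤
      99 * Csh * Real.exp 99 * Real.exp (-(8 / 10) * α) := by
  have hr2 : 0 < r ^ 2 := by positivity
  have hbpos : 0 < α + d / 2 := by positivity
  have hq : Real.log (3 * t₀ * ((α + d / 2) / (r ^ 2 / 16))) ≤ -2 := by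
    refine log_le_neg_two (by positivity) ?_
    rw [show 3 * t₀ * ((α + d / 2) / (r ^ 2 / 16)) = 48 * t₀ * α / r ^ 2 + 24 * t₀ * d / r ^ 2 by
      field_simp; ring]
    have e1 : 48 * t₀ * α / r ^ 2 = 12 / 100 := by
      rw [hα]
      field_simp
      ring
    have e2 : 24 * t₀ * d / r ^ 2 ≤ 1 / 100 := by
      rw [div_le_iff₀ hr2]
      have : t₀ * d ≤ 3 * t₀ := by nlinarith
      nlinarith
    rw [e1]
    linarith
  have hlog2 : Real.log (3 * t₀ * ((α + d / 2) / (r ^ 2 / 16))) =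
      Real.log (3 * t₀) + Real.log ((α + d / 2) / (r ^ 2 / 16)) :=
    Real.log_mul (by positivity) (by positivity)
  have s1 : (α + d / 2) * Real.log ((α + d / 2) / (r ^ 2 / 16)) + (α + d / 2) * Real.log (3 * t₀) ≤
      -2 * (α + d / 2) := by
    have := mul_le_mul_of_nonneg_left hq hbpos.le
    rw [hlog2] at this
    linarith
  have hlog1 : Real.log (3 * t₀ / S) = Real.log (3 * t₀) - Real.log S := Real.log_div (by positivity) hS.ne'
  have heA : ((α + d / 2) * Real.log ((α + d / 2) / (r ^ 2 / 16)) - (α + d / 2) + α * Real.log S + α) -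
      (-(d / 2) * Real.log (3 * t₀) - α * Real.log (3 * t₀ / S)) ≤ -α := by
    rw [hlog1]
    have eq : ((α + d / 2) * Real.log ((α + d / 2) / (r ^ 2 / 16)) - (α + d / 2) + α * Real.log S + α) -
        (-(d / 2) * Real.log (3 * t₀) - α * (Real.log (3 * t₀) - Real.log S)) =
        ((α + d / 2) * Real.log ((α + d / 2) / (r ^ 2 / 16)) + (α + d / 2) * Real.log (3 * t₀)) -
          (α + d / 2) + α := by ring
    rw [eq]
    linarith
  have e : (t₀ / (10 * S) * Real.exp (-(d / 2) * Real.log (3 * t₀) - α * Real.log (3 * t₀ / S)))⁻¹ *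
      (33 / 10 * S * (Csh * Real.exp ((α + d / 2) * Real.log ((α + d / 2) / (r ^ 2 / 16)) - (α + d / 2) +
        α * Real.log S + α) * (3 * T⁻¹))) = 99 * Csh * (S ^ 2 / (t₀ * T)) *
      Real.exp (((α + d / 2) * Real.log ((α + d / 2) / (r ^ 2 / 16)) - (α + d / 2) + α * Real.log S + α) -
        (-(d / 2) * Real.log (3 * t₀) - α * Real.log (3 * t₀ / S))) := by
    have hE₁0 : Real.exp (-(d / 2) * Real.log (3 * t₀) - α * Real.log (3 * t₀ / S)) ≠ 0 := (Real.exp_pos _).ne'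
    have hsplit : Real.exp (((α + d / 2) * Real.log ((α + d / 2) / (r ^ 2 / 16)) - (α + d / 2) + α * Real.log S + α) -
        (-(d / 2) * Real.log (3 * t₀) - α * Real.log (3 * t₀ / S))) =
        Real.exp ((α + d / 2) * Real.log ((α + d / 2) / (r ^ 2 / 16)) - (α + d / 2) + α * Real.log S + α) /
          Real.exp (-(d / 2) * Real.log (3 * t₀) - α * Real.log (3 * t₀ / S)) := Real.exp_sub _ _
    rw [hsplit]
    generalize Real.exp (-(d / 2) * Real.log (3 * t₀) - α * Real.log (3 * t₀ / S)) = E₁ at hE₁0 ⊢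
    generalize Real.exp ((α + d / 2) * Real.log ((α + d / 2) / (r ^ 2 / 16)) - (α + d / 2) +
      α * Real.log S + α) = E₂
    field_simp
    ring
  rw [e]
  exact coeffX_le (by positivity) (by positivity) hP heA

/-- **Top coefficient.** [folklore] -/
theorem coef_top_le {T t₀ t₁ T₀ S α d Cψ : ℝ} (hT : 0 < T) (ht₀ : 0 < t₀) (ht₁ : 0 ≤ t₁) (hS : S = T₀ + t₁)
    (hSpos : 0 < S) (hd0 : 0 ≤ d) (hCψ : 0 ≤ Cψ) (hαpos : 0 < α) (hT₀ : T / 200 ≤ T₀) (ht₀T : 8000 * t₀ ≤ T)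
    (hP : S ^ 2 / (t₀ * T) ≤ α) :
    (t₀ / (10 * S) * Real.exp (-(d / 2) * Real.log (3 * t₀) - α * Real.log (3 * t₀ / S)))⁻¹ *
        (2 * ((T₀ + t₁) + (T₀ + t₁) ^ 2 / (10 * S)) * (Real.exp (-(d / 2) * Real.log S + α) * (6 + Cψ) * (200 / T))) ≤
      4400 * (6 + Cψ) * Real.exp 99 * Real.exp (-(8 / 10) * α) := by
  have hbpos : 0 < α + d / 2 := by positivity
  have hq2 : Real.log (3 * t₀ / S) ≤ -2 := by
    refine log_le_neg_two (by positivity) ?_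
    rw [← mul_div_assoc, div_le_one hSpos, hS]
    nlinarith
  have hlog1 : Real.log (3 * t₀ / S) = Real.log (3 * t₀) - Real.log S := Real.log_div (by positivity) hSpos.ne'
  have s2 : (α + d / 2) * Real.log (3 * t₀ / S) ≤ -2 * (α + d / 2) := by
    have := mul_le_mul_of_nonneg_left hq2 hbpos.le
    linarith
  have heB : (-(d / 2) * Real.log S + α) - (-(d / 2) * Real.log (3 * t₀) - α * Real.log (3 * t₀ / S)) ≤ -α := by
    have eq : (-(d / 2) * Real.log S + α) - (-(d / 2) * Real.log (3 * t₀) - α * Real.log (3 * t₀ / S)) =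
        (α + d / 2) * Real.log (3 * t₀ / S) + α := by
      rw [hlog1]
      ring
    rw [eq]
    linarith
  have hmT : (T₀ + t₁) + (T₀ + t₁) ^ 2 / (10 * S) = 11 / 10 * S := by
    rw [hS]
    have : T₀ + t₁ ≠ 0 := by rw [← hS]; exact hSpos.ne'
    field_simp
    ring
  have e : (t₀ / (10 * S) * Real.exp (-(d / 2) * Real.log (3 * t₀) - α * Real.log (3 * t₀ / S)))⁻¹ *
      (2 * ((T₀ + t₁) + (T₀ + t₁) ^ 2 / (10 * S)) * (Real.exp (-(d / 2) * Real.log S + α) * (6 + Cψ) * (200 / T))) =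
      4400 * (6 + Cψ) * (S ^ 2 / (t₀ * T)) *
        Real.exp ((-(d / 2) * Real.log S + α) - (-(d / 2) * Real.log (3 * t₀) - α * Real.log (3 * t₀ / S))) := by
    have hE₁0 : Real.exp (-(d / 2) * Real.log (3 * t₀) - α * Real.log (3 * t₀ / S)) ≠ 0 := (Real.exp_pos _).ne'
    have hsplit : Real.exp ((-(d / 2) * Real.log S + α) - (-(d / 2) * Real.log (3 * t₀) - α * Real.log (3 * t₀ / S))) =
        Real.exp (-(d / 2) * Real.log S + α) / Real.exp (-(d / 2) * Real.log (3 * t₀) - α * Real.log (3 * t₀ / S)) :=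
      Real.exp_sub _ _
    rw [hmT, hsplit]
    generalize Real.exp (-(d / 2) * Real.log (3 * t₀) - α * Real.log (3 * t₀ / S)) = E₁ at hE₁0 ⊢
    generalize Real.exp (-(d / 2) * Real.log S + α) = E₂
    have hT0 : T ≠ 0 := hT.ne'
    have hT₀0 : T₀ + t₁ ≠ 0 := by rw [← hS]; exact hSpos.ne'
    field_simp
    ring
  rw [e]
  exact coeffX_le (by positivity) (by positivity) hP heB

/-- **Bottom coefficient.** [folklore] -/
theorem coef_bottom_le {t₀ t₁ S α d : ℝ} (ht₀ : 0 < t₀) (ht₁ : 0 < t₁) (ht₁₀ : t₁ ≤ t₀) (hSpos : 0 < S)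
    (hd0 : 0 ≤ d) (hd3 : d ≤ 3) (hαpos : 0 < α) (hQ : S / t₀ ≤ α) :
    (t₀ / (10 * S) * Real.exp (-(d / 2) * Real.log (3 * t₀) - α * Real.log (3 * t₀ / S)))⁻¹ *
        (11 / 10 * α * Real.exp (α * Real.log (S / t₁) + α)) ≤
      t₀ ^ (d / 2) * (11 * Real.exp 3 * Real.exp (5 * α * Real.log (Real.exp 1 * t₀ / t₁))) := by
  have hL1 : 1 ≤ Real.log (Real.exp 1 * t₀ / t₁) := by
    rw [mul_div_assoc, Real.log_mul (Real.exp_pos 1).ne' (by positivity), Real.log_exp]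
    have : 0 ≤ Real.log (t₀ / t₁) := Real.log_nonneg (by rw [le_div_iff₀ ht₁]; linarith)
    linarith
  have hlog1 : Real.log (3 * t₀ / S) = Real.log 3 + Real.log t₀ - Real.log S := by
    rw [Real.log_div (by positivity) hSpos.ne', Real.log_mul (by norm_num) ht₀.ne']
  have hlog2 : Real.log (S / t₁) = Real.log S - Real.log t₁ := Real.log_div hSpos.ne' ht₁.ne'
  have hlog3 : Real.log (3 * t₀) = Real.log 3 + Real.log t₀ := Real.log_mul (by norm_num) ht₀.ne'
  have hlogL : Real.log (Real.exp 1 * t₀ / t₁) = 1 + Real.log t₀ - Real.log t₁ := by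
    rw [mul_div_assoc, Real.log_mul (Real.exp_pos 1).ne' (by positivity), Real.log_exp,
      Real.log_div ht₀.ne' ht₁.ne']
    ring
  have hrpow : t₀ ^ (d / 2) = Real.exp (Real.log t₀ * (d / 2)) := Real.rpow_def_of_pos ht₀ _
  -- normal form: everything as one exponential
  have e : (t₀ / (10 * S) * Real.exp (-(d / 2) * Real.log (3 * t₀) - α * Real.log (3 * t₀ / S)))⁻¹ *
      (11 / 10 * α * Real.exp (α * Real.log (S / t₁) + α)) = t₀ ^ (d / 2) * (11 * (S / t₀) * α *
        Real.exp (d / 2 * Real.log 3 + α * (2 + Real.log (Real.exp 1 * t₀ / t₁)) -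
          α * (2 - Real.log 3))) := by
    rw [hrpow, hlog1, hlog2, hlog3, hlogL, mul_inv, ← Real.exp_neg]
    have key : ∀ a b c p : ℝ, a + b = p + c →
        (t₀ / (10 * S))⁻¹ * Real.exp a * (11 / 10 * α * Real.exp b) =
          Real.exp p * (11 * (S / t₀) * α * Real.exp c) := by
      intro a b c p h
      have h2 : Real.exp a * Real.exp b = Real.exp p * Real.exp c := by rw [← Real.exp_add, ← Real.exp_add, h]
      field_simp
      nlinarith [h2]
    refine key _ _ _ _ ?_
    ring
  rw [e]
  refine mul_le_mul_of_nonneg_left ?_ (by positivity)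
  have hlog3le : Real.log 3 ≤ 2 := by
    have := Real.log_le_sub_one_of_pos (by norm_num : (0 : ℝ) < 3)
    linarith
  have step : Real.exp (d / 2 * Real.log 3 + α * (2 + Real.log (Real.exp 1 * t₀ / t₁)) - α * (2 - Real.log 3)) ≤
      Real.exp (d / 2 * Real.log 3 + α * (2 + Real.log (Real.exp 1 * t₀ / t₁))) :=
    Real.exp_le_exp.2 (by nlinarith)
  refine (mul_le_mul_of_nonneg_left step (by positivity)).trans ?_
  exact coeffY_le (by positivity) hQ (by positivity) (by linarith) le_rfl hL1

end Coefficients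

/-! ### Prop. 4.3 -/

section Main

variable {E : Type*} [NormedAddCommGroup E] [InnerProductSpace ℝ E] [FiniteDimensional ℝ E]
  [MeasurableSpace E] [BorelSpace E]
variable {F : Type*} [NormedAddCommGroup F] [InnerProductSpace ℝ F]

set_option maxHeartbeats 1600000 in
/-- **The analytic part of Prop. 4.3**: for a pigeonholed `T₀ ∈ [T/200, T/100]` with
`φ(T₀) ≤ (200/T) X`, the core inequality and the weight bounds give
`c₀ ∫_{t₀}^{2t₀} Z ≤ A₂ X + B₂ X + C₂ Y` with the explicit coefficients of
`coef_shell_le`, `coef_top_le`, `coef_bottom_le`. [cite: Tao2021QuantitativeNS, Prop. 4.3 (proof, pp. 33–35)] -/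
theorem second_carleman_assembled (hd3 : Module.finrank ℝ E ≤ 3) {Cψ : ℝ} (hCψ : 0 ≤ Cψ) {ψ : ℝ × E → ℝ}
    {T r t₀ t₁ T₀ : ℝ} {u : ℝ → E → F} (hT : 0 < T) (hr : 0 < r) (hrT : 4000 * T ≤ r ^ 2) (ht₁ : 0 < t₁)
    (ht₁₀ : t₁ ≤ t₀) (ht₀T : 8000 * t₀ ≤ T) (hu : ContDiffOn ℝ 2 (uncurry u) (Icc 0 T ×ˢ univ))
    (hL : ∀ t ∈ Ioo 0 T, ∀ x ∈ closedBall (0 : E) r,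
      ‖FluidPDE.timeDeriv u t x + Δ (u t) x‖ ≤ T⁻¹ * ‖u t x‖ + (Real.sqrt T)⁻¹ * ‖fderiv ℝ (u t) x‖)
    (hψs : ContDiff ℝ (⊤ : ℕ∞) ψ)
    (hψ1 : ∀ z : ℝ × E, ‖z.2‖ ≤ r / 2 → ψ z = 1) (hψ0 : ∀ z : ℝ × E, r ^ 2 / 2 ≤ ‖z.2‖ ^ 2 → ψ z = 0)
    (hψnn : ∀ z, 0 ≤ ψ z) (hψle : ∀ z, ψ z ≤ 1) (hψt : ∀ z, dt ψ z = 0)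
    (hψg : ∀ z, gradSq ψ z ≤ Cψ / r ^ 2) (hψl : ∀ z, |lap ψ z| ≤ Cψ / r ^ 2)
    (hψin : ∀ z : ℝ × E, ‖z.2‖ < r / 2 → (∀ e, dx e ψ z = 0) ∧ lap ψ z = 0)
    (hψout : ∀ z : ℝ × E, r ^ 2 / 2 < ‖z.2‖ ^ 2 → (∀ e, dx e ψ z = 0) ∧ lap ψ z = 0)
    (hT₀mem : T₀ ∈ Icc (T / 200) (T / 100))
    (hφT₀ : ∫ x in ball (0 : E) r, (T⁻¹ * ‖u T₀ x‖ ^ 2 + ‖fderiv ℝ (u T₀) x‖ ^ 2) ≤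
      200 / T * ∫ t in (0 : ℝ)..T, ∫ x in ball (0 : E) r, (T⁻¹ * ‖u t x‖ ^ 2 + ‖fderiv ℝ (u t) x‖ ^ 2)) :
    t₀ / (10 * (T₀ + t₁)) * Real.exp (-((Module.finrank ℝ E : ℝ) / 2) * Real.log (3 * t₀) -
        r ^ 2 / (400 * t₀) * Real.log (3 * t₀ / (T₀ + t₁))) *
        ∫ t in t₀..2 * t₀, ∫ x in ball (0 : E) (r / 2),
          (T⁻¹ * ‖u t x‖ ^ 2 + ‖fderiv ℝ (u t) x‖ ^ 2) * Real.exp (-‖x‖ ^ 2 / (4 * t)) ≤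
      33 / 10 * (T₀ + t₁) * (4 * (2 + Cψ ^ 2 + 4 * Cψ) *
          Real.exp ((r ^ 2 / (400 * t₀) + (Module.finrank ℝ E : ℝ) / 2) *
            Real.log ((r ^ 2 / (400 * t₀) + (Module.finrank ℝ E : ℝ) / 2) / (r ^ 2 / 16)) -
            (r ^ 2 / (400 * t₀) + (Module.finrank ℝ E : ℝ) / 2) + r ^ 2 / (400 * t₀) * Real.log (T₀ + t₁) +
            r ^ 2 / (400 * t₀)) * (3 * T⁻¹)) *
          (∫ t in (0 : ℝ)..T, ∫ x in ball (0 : E) r, (T⁻¹ * ‖u t x‖ ^ 2 + ‖fderiv ℝ (u t) x‖ ^ 2)) +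
        2 * ((T₀ + t₁) + (T₀ + t₁) ^ 2 / (10 * (T₀ + t₁))) *
          (Real.exp (-((Module.finrank ℝ E : ℝ) / 2) * Real.log (T₀ + t₁) + r ^ 2 / (400 * t₀)) * (6 + Cψ) *
            (200 / T)) *
          (∫ t in (0 : ℝ)..T, ∫ x in ball (0 : E) r, (T⁻¹ * ‖u t x‖ ^ 2 + ‖fderiv ℝ (u t) x‖ ^ 2)) +
        11 / 10 * (r ^ 2 / (400 * t₀)) * Real.exp (r ^ 2 / (400 * t₀) * Real.log ((T₀ + t₁) / t₁) +
            r ^ 2 / (400 * t₀)) *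
          ∫ x in ball (0 : E) r, ‖u 0 x‖ ^ 2 * (t₁ ^ (-(Module.finrank ℝ E : ℝ) / 2) *
            Real.exp (-‖x‖ ^ 2 / (4 * t₁))) := by
  have ht₀ : 0 < t₀ := lt_of_lt_of_le ht₁ ht₁₀
  have hT₀ : 0 < T₀ := lt_of_lt_of_le (by positivity) hT₀mem.1
  have hT₀T : T₀ < T := lt_of_le_of_lt hT₀mem.2 (by linarith)
  -- parameters
  obtain ⟨S, hS⟩ : ∃ S : ℝ, S = T₀ + t₁ := ⟨_, rfl⟩
  obtain ⟨α, hα⟩ : ∃ α : ℝ, α = r ^ 2 / (400 * t₀) := ⟨_, rfl⟩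
  rw [← hS, ← hα]
  have hSpos : 0 < S := by rw [hS]; positivity
  have ht₁S : t₁ ≤ S := by rw [hS]; linarith
  have hαpos : 0 < α := by rw [hα]; positivity
  have hα10 : 10 * T ≤ α * t₀ := by
    rw [hα, div_mul_eq_mul_div, le_div_iff₀ (by positivity)]
    nlinarith
  have h22 : 22 * S ≤ T := by rw [hS]; linarith [hT₀mem.2]
  have h44 : 44 * S ^ 2 ≤ 9 * α * T ^ 2 := by
    have h1 : S ^ 2 ≤ (T / 50) ^ 2 := pow_le_pow_left₀ hSpos.le (by rw [hS]; linarith [hT₀mem.2]) 2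
    have : 10 ≤ α := by nlinarith
    nlinarith
  have hrT' : T ≤ r ^ 2 := by linarith
  have hrT2 : 2 * T ≤ r ^ 2 := by linarith
  have h2t₀ : 2 * t₀ ≤ T₀ := by linarith [hT₀mem.1]
  have hαT : t₀ * T⁻¹ ≤ 9 / 2 * α := by
    have : t₀ * T⁻¹ ≤ 1 := by
      rw [mul_inv_le_iff₀ hT]
      linarith
    nlinarith
  -- functions
  obtain ⟨φ, hφ⟩ : ∃ φ : ℝ → ℝ, φ = fun t => ∫ x in ball (0 : E) r, (T⁻¹ * ‖u t x‖ ^ 2 + ‖fderiv ℝ (u t) x‖ ^ 2) :=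
    ⟨_, rfl⟩
  obtain ⟨cφ, hφ0⟩ := continuousOn_phi hT hu hφ
  have iφ : IntervalIntegrable φ volume 0 T := cφ.intervalIntegrable_of_Icc hT.le
  have hX0 : 0 ≤ ∫ t in (0 : ℝ)..T, φ t := intervalIntegral.integral_nonneg hT.le fun t _ => hφ0 t
  have hφT₀' : φ T₀ ≤ 200 / T * ∫ t in (0 : ℝ)..T, φ t := by rw [hφ]; exact hφT₀
  obtain ⟨g, hg⟩ : ∃ g : ℝ × E → ℝ, g = fun z : ℝ × E => -‖z.2‖ ^ 2 / (4 * (z.1 + t₁)) -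
      (Module.finrank ℝ E : ℝ) / 2 * Real.log (z.1 + t₁) - α * Real.log ((z.1 + t₁) / S) + α * (z.1 + t₁) / S :=
    ⟨_, rfl⟩
  obtain ⟨GS, hGS⟩ : ∃ GS : ℝ × E → ℝ, GS = fun z : ℝ × E =>
      ∑ i, ‖fderiv ℝ (u z.1) z.2 (stdOrthonormalBasis ℝ E i)‖ ^ 2 := ⟨_, rfl⟩
  obtain ⟨Psh, hPsh⟩ : ∃ Psh : ℝ → ℝ, Psh = fun t => ∫ x in ball (0 : E) r \ ball 0 (r / 2),
      4 * (2 + Cψ ^ 2 + 4 * Cψ) * (T⁻¹ ^ 2 * ‖u t x‖ ^ 2 + T⁻¹ * GS (t, x)) * Real.exp (g (t, x)) := ⟨_, rfl⟩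
  obtain ⟨Iin, hIin⟩ : ∃ Iin : ℝ → ℝ, Iin = fun t => ∫ x in ball (0 : E) (r / 2),
      ((t + t₁) / (10 * S) * GS (t, x) + 9 * α / (20 * S) * ‖u t x‖ ^ 2) * Real.exp (g (t, x)) := ⟨_, rfl⟩
  obtain ⟨GW, hGW⟩ : ∃ GW : ℝ × E → ℝ, GW = fun z : ℝ × E => ∑ i, ‖ψ z • fderiv ℝ (u z.1) z.2
      (stdOrthonormalBasis ℝ E i) + dx (stdOrthonormalBasis ℝ E i) ψ z • u z.1 z.2‖ ^ 2 := ⟨_, rfl⟩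
  obtain ⟨Eb, hEb⟩ : ∃ Eb : ℝ → ℝ, Eb = fun t => ∫ x, (GW (t, x) + 1 / 2 * (α / S - α / (t + t₁)) *
      ‖ψ (t, x) • u t x‖ ^ 2) * Real.exp (g (t, x)) := ⟨_, rfl⟩
  obtain ⟨Qp, hQp⟩ : ∃ Qp : ℝ → ℝ, Qp = fun t => ∫ x, ((t + t₁) / (10 * S) * GW (t, x) + 9 * α / (20 * S) *
      ‖ψ (t, x) • u t x‖ ^ 2) * Real.exp (g (t, x)) := ⟨_, rfl⟩
  obtain ⟨Pin, hPin⟩ : ∃ Pin : ℝ → ℝ, Pin = fun t => ∫ x in ball (0 : E) (r / 2),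
      2 * (T⁻¹ ^ 2 * ‖u t x‖ ^ 2 + T⁻¹ * GS (t, x)) * Real.exp (g (t, x)) := ⟨_, rfl⟩
  -- the core inequality
  have core := core_second_carleman (E := E) (F := F) hT hr ht₁ hT₀ hT₀T hS hαpos.le hu hψs hψ1 hψ0 hψnn hψle
    hψg hψin hψout (W := fun z => ψ z • uncurry u z) rfl hGS hGW hg hEb hQp hPin hPsh hIin hCψ hrT' hψt hψl hL
    h22 h44
  -- continuity / sign of `I_in` and of `Z`
  have cIin : ContinuousOn Iin (Icc 0 T) := by
    have := continuousOn_setIntegral_GS hT ht₁ hT₀ hS hu hGS hg (measurableSet_ball (x := (0 : E)) (ε := r / 2))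
      isBounded_ball ((continuous_id.add continuous_const).div_const (10 * S))
      (c₁ := fun t => (t + t₁) / (10 * S)) (9 * α / (20 * S))
    rw [hIin]
    exact this
  have hIin0 : ∀ t, 0 ≤ t → 0 ≤ Iin t := fun t ht => by
    rw [hIin]
    refine setIntegral_nonneg measurableSet_ball fun x _ => ?_
    have := (GS_compare hGS (t, x)).2.2
    have : 0 ≤ t + t₁ := by linarith
    positivity
  obtain ⟨Z, hZ⟩ : ∃ Z : ℝ → ℝ, Z = fun t => ∫ x in ball (0 : E) (r / 2),
      (T⁻¹ * ‖u t x‖ ^ 2 + ‖fderiv ℝ (u t) x‖ ^ 2) * Real.exp (-‖x‖ ^ 2 / (4 * t)) := ⟨_, rfl⟩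
  have cZ : ContinuousOn Z (Icc t₀ (2 * t₀)) := by
    have hsub : Icc t₀ (2 * t₀) ×ˢ (univ : Set E) ⊆ Icc 0 T ×ˢ univ :=
      prod_mono (Icc_subset_Icc ht₀.le (by linarith)) Subset.rfl
    have c1 : ContinuousOn (fun z : ℝ × E => T⁻¹ * ‖u z.1 z.2‖ ^ 2 + ‖fderiv ℝ (u z.1) z.2‖ ^ 2)
        (Icc t₀ (2 * t₀) ×ˢ univ) :=
      ((continuousOn_const.mul ((hu.continuousOn.norm).pow 2)).add
        (continuousOn_norm_sliceFDeriv_sq hT hu (by norm_num))).mono hsub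
    have c2 : ContinuousOn (fun z : ℝ × E => Real.exp (-‖z.2‖ ^ 2 / (4 * z.1))) (Icc t₀ (2 * t₀) ×ˢ univ) := by
      refine Real.continuous_exp.comp_continuousOn ?_
      refine ((continuous_snd.norm.pow 2).neg.continuousOn).div (continuousOn_const.mul continuousOn_fst) ?_
      intro z hz
      have : 0 < z.1 := lt_of_lt_of_le ht₀ hz.1.1
      positivity
    rw [hZ]
    exact continuousOn_setIntegral_slice measurableSet_ball isBounded_ball
      ((c1.mul c2).mono (prod_mono Subset.rfl (subset_univ _)))
  -- (L) the left-hand side against `∫₀^{T₀} I_in`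
  have hL1 : t₀ / (10 * S) * Real.exp (-((Module.finrank ℝ E : ℝ) / 2) * Real.log (3 * t₀) - α * Real.log (3 * t₀ / S)) *
      ∫ t in t₀..2 * t₀, Z t ≤ ∫ t in (0 : ℝ)..T₀, Iin t := by
    have step1 : ∫ t in t₀..2 * t₀, t₀ / (10 * S) *
        Real.exp (-((Module.finrank ℝ E : ℝ) / 2) * Real.log (3 * t₀) - α * Real.log (3 * t₀ / S)) * Z t ≤
        ∫ t in t₀..2 * t₀, Iin t := by
      refine intervalIntegral.integral_mono_on (by linarith) ((cZ.intervalIntegrable_of_Icc (by linarith)).const_mul _)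
        ((cIin.mono (Icc_subset_Icc ht₀.le (by linarith))).intervalIntegrable_of_Icc (by linarith)) fun t ht => ?_
      have := Iin_lower (r := r) hT ht₁ hT₀ hT₀T hS hu hGS hg ht₁₀ h2t₀ hαpos.le hαT ht
      rw [hIin, hZ]
      exact this
    have step2 : ∫ t in t₀..2 * t₀, Iin t ≤ ∫ t in (0 : ℝ)..T₀, Iin t :=
      intervalIntegral.integral_mono_interval ht₀.le (by linarith) h2t₀
        ((ae_restrict_iff' measurableSet_Ioc).2 (Eventually.of_forall fun t ht => hIin0 t ht.1.le))
        ((cIin.mono (Icc_subset_Icc_right hT₀T.le)).intervalIntegrable_of_Icc hT₀.le)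
    rw [intervalIntegral.integral_const_mul] at step1
    exact step1.trans step2
  -- (U1) the shell term against `X`
  have hU1 : ∫ t in (0 : ℝ)..T₀, ((t + t₁) + (t + t₁) ^ 2 / (10 * S)) * Psh t ≤
      33 / 10 * S * (4 * (2 + Cψ ^ 2 + 4 * Cψ) * Real.exp ((α + (Module.finrank ℝ E : ℝ) / 2) *
        Real.log ((α + (Module.finrank ℝ E : ℝ) / 2) / (r ^ 2 / 16)) - (α + (Module.finrank ℝ E : ℝ) / 2) +
          α * Real.log S + α) * (3 * T⁻¹)) * ∫ t in (0 : ℝ)..T, φ t := by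
    have cPsh : ContinuousOn Psh (Icc 0 T₀) := by
      have := continuousOn_setIntegral_GS hT ht₁ hT₀ hS hu hGS hg (measurableSet_ball.diff measurableSet_ball)
        (isBounded_ball.subset Set.sdiff_subset) continuous_const
        (c₁ := fun _ => 4 * (2 + Cψ ^ 2 + 4 * Cψ) * T⁻¹) (4 * (2 + Cψ ^ 2 + 4 * Cψ) * T⁻¹ ^ 2)
        (A := ball (0 : E) r \ ball 0 (r / 2))
      rw [hPsh]
      refine (this.mono (Icc_subset_Icc_right hT₀T.le)).congr fun t _ => ?_
      refine setIntegral_congr_fun (measurableSet_ball.diff measurableSet_ball) fun x _ => ?_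
      ring
    have cm : Continuous fun t : ℝ => (t + t₁) + (t + t₁) ^ 2 / (10 * S) := by fun_prop
    have hA0 : 0 ≤ 33 / 10 * S * (4 * (2 + Cψ ^ 2 + 4 * Cψ) * Real.exp ((α + (Module.finrank ℝ E : ℝ) / 2) *
        Real.log ((α + (Module.finrank ℝ E : ℝ) / 2) / (r ^ 2 / 16)) - (α + (Module.finrank ℝ E : ℝ) / 2) +
          α * Real.log S + α) * (3 * T⁻¹)) := by positivity
    have step1 : ∫ t in (0 : ℝ)..T₀, ((t + t₁) + (t + t₁) ^ 2 / (10 * S)) * Psh t ≤ ∫ t in (0 : ℝ)..T₀,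
        33 / 10 * S * (4 * (2 + Cψ ^ 2 + 4 * Cψ) * Real.exp ((α + (Module.finrank ℝ E : ℝ) / 2) *
          Real.log ((α + (Module.finrank ℝ E : ℝ) / 2) / (r ^ 2 / 16)) - (α + (Module.finrank ℝ E : ℝ) / 2) +
            α * Real.log S + α) * (3 * T⁻¹)) * φ t := by
      refine intervalIntegral.integral_mono_on hT₀.le ((cm.continuousOn.mul cPsh).intervalIntegrable_of_Icc hT₀.le)
        (((cφ.mono (Icc_subset_Icc_right hT₀T.le)).intervalIntegrable_of_Icc hT₀.le).const_mul _) fun t ht => ?_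
      have := m_Psh_le hT hr ht₁ hT₀ hT₀T hS hu hGS hg hφ hd3 hαpos hCψ ht
      rw [hPsh]
      exact this
    refine step1.trans ?_
    rw [intervalIntegral.integral_const_mul]
    refine mul_le_mul_of_nonneg_left ?_ hA0
    exact intervalIntegral.integral_mono_interval le_rfl hT₀.le hT₀T.le (Eventually.of_forall fun t => hφ0 t) iφ
  -- (U2) the top term against `X`
  have hmS : (T₀ + t₁) + (T₀ + t₁) ^ 2 / (10 * S) = S + S ^ 2 / (10 * S) := by rw [hS]
  rw [hmS] at core
  have hU2 : 2 * (S + S ^ 2 / (10 * S)) *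
      (∫ x in ball (0 : E) r, (2 * GS (T₀, x) + 2 * (Cψ / r ^ 2) * ‖u T₀ x‖ ^ 2) * Real.exp (g (T₀, x))) ≤
      2 * (S + S ^ 2 / (10 * S)) * (Real.exp (-((Module.finrank ℝ E : ℝ) / 2) * Real.log S + α) *
        (6 + Cψ) * (200 / T)) * ∫ t in (0 : ℝ)..T, φ t := by
    have htop := top_le hT hr ht₁ hT₀ hT₀T hS hu hGS hg hφ hd3 hCψ hrT2
    have h1 : Real.exp (-((Module.finrank ℝ E : ℝ) / 2) * Real.log S + α) * (6 + Cψ) * φ T₀ ≤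
        Real.exp (-((Module.finrank ℝ E : ℝ) / 2) * Real.log S + α) * (6 + Cψ) * (200 / T * ∫ t in (0 : ℝ)..T, φ t) :=
      mul_le_mul_of_nonneg_left hφT₀' (by positivity)
    have hm0 : 0 ≤ 2 * (S + S ^ 2 / (10 * S)) := by positivity
    have := mul_le_mul_of_nonneg_left (htop.trans h1) hm0
    refine this.trans (le_of_eq ?_)
    ring
  -- (U3) the bottom term against `Y`
  have hU3 : 11 / 10 * α * ∫ x in ball (0 : E) r, ‖u 0 x‖ ^ 2 * Real.exp (g (0, x)) ≤
      11 / 10 * α * Real.exp (α * Real.log (S / t₁) + α) *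
        ∫ x in ball (0 : E) r, ‖u 0 x‖ ^ 2 * (t₁ ^ (-(Module.finrank ℝ E : ℝ) / 2) *
          Real.exp (-‖x‖ ^ 2 / (4 * t₁))) := by
    have h0c : (0 : ℝ) ∈ Icc 0 T := ⟨le_rfl, hT.le⟩
    have cu : ContinuousOn (fun z : ℝ × E => ‖u z.1 z.2‖ ^ 2) (Icc 0 T ×ˢ univ) := (hu.continuousOn.norm).pow 2
    have i1 : IntegrableOn (fun x : E => ‖u 0 x‖ ^ 2 * Real.exp (g (0, x))) (ball (0 : E) r) :=
      integrableOn_slab_slice (Φ := fun z : ℝ × E => ‖u z.1 z.2‖ ^ 2 * Real.exp (g z))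
        (cu.mul (continuousOn_exp_gaussWeight_slab (E := E) (T := T) ht₁ hT₀ hS hg)) h0c isBounded_ball
    have i2 : IntegrableOn (fun x : E => ‖u 0 x‖ ^ 2 * (t₁ ^ (-(Module.finrank ℝ E : ℝ) / 2) *
        Real.exp (-‖x‖ ^ 2 / (4 * t₁)))) (ball (0 : E) r) :=
      integrableOn_slab_slice (Φ := fun z : ℝ × E => ‖u z.1 z.2‖ ^ 2 * (t₁ ^ (-(Module.finrank ℝ E : ℝ) / 2) *
        Real.exp (-‖z.2‖ ^ 2 / (4 * t₁)))) (cu.mul (continuousOn_const.mul (Real.continuous_exp.comp_continuousOn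
          (((continuous_snd.norm.pow 2).neg.div_const _).continuousOn)))) h0c isBounded_ball
    have := bottom_le ht₁ hg ht₁S hαpos.le i1 i2
    have h2 := mul_le_mul_of_nonneg_left this (by positivity : (0 : ℝ) ≤ 11 / 10 * α)
    refine h2.trans (le_of_eq ?_)
    ring
  -- assemble
  have hZdef : ∫ t in t₀..2 * t₀, Z t = ∫ t in t₀..2 * t₀, ∫ x in ball (0 : E) (r / 2),
      (T⁻¹ * ‖u t x‖ ^ 2 + ‖fderiv ℝ (u t) x‖ ^ 2) * Real.exp (-‖x‖ ^ 2 / (4 * t)) := by rw [hZ]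
  have hXdef : (∫ t in (0 : ℝ)..T, ∫ x in ball (0 : E) r, (T⁻¹ * ‖u t x‖ ^ 2 + ‖fderiv ℝ (u t) x‖ ^ 2)) =
      ∫ t in (0 : ℝ)..T, φ t := by rw [hφ]
  rw [← hZdef, hXdef]
  linarith [hL1, core, hU1, hU2, hU3]

set_option maxHeartbeats 800000 in
/-- **Tao 2021, Proposition 4.3 (second Carleman inequality).** In dimension `d ≤ 3` there is
`K > 0` (depending only on `E`) such that: for `T, r > 0` with `r² ≥ 4000 T`, times
`0 < t₁ ≤ t₀ ≤ T/8000`, and `u : [0, T] × E → F` with `uncurry u` of class `C²` on the closed slab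
obeying `|∂ₜu + Δu| ≤ T⁻¹|u| + T^{-1/2}|∇u|` on `]0,T[ × B̄(0,r)` ((4.4) with `C₀ = 1`),
`∫_{t₀}^{2t₀} ∫_{|x|<r/2} (T⁻¹|u|² + |∇u|²) e^{−|x|²/4t} dx dt
  ≤ K ( e^{−r²/(500 t₀)} X + t₀^{d/2} exp(K (r²/t₀) log(e t₀/t₁)) Y )`,
`X = ∫₀ᵀ ∫_{|x|<r} (T⁻¹|u|² + |∇u|²)`, `Y = ∫_{|x|<r} |u(0,x)|² t₁^{−d/2} e^{−|x|²/4t₁}` ((4.5); Tao's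
`t₀^{3/2} (et₀/t₁)^{O(r²/t₀)}` for `d = 3`; `|∇u|` the operator norm of `D(u t)(x)`). See the
module docstring for the rendering of the constants. [cite: Tao2021QuantitativeNS, Prop. 4.3] -/
theorem second_carleman_inequality (hd3 : Module.finrank ℝ E ≤ 3) :
    ∃ K : ℝ, 0 < K ∧ ∀ (T r t₀ t₁ : ℝ) (u : ℝ → E → F),
      0 < T → 0 < r → 4000 * T ≤ r ^ 2 → 0 < t₁ → t₁ ≤ t₀ → 8000 * t₀ ≤ T →
      ContDiffOn ℝ 2 (uncurry u) (Icc 0 T ×ˢ univ) →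
      (∀ t ∈ Ioo 0 T, ∀ x ∈ closedBall (0 : E) r,
        ‖FluidPDE.timeDeriv u t x + Δ (u t) x‖ ≤ T⁻¹ * ‖u t x‖ + (Real.sqrt T)⁻¹ * ‖fderiv ℝ (u t) x‖) →
      ∫ t in t₀..2 * t₀, ∫ x in ball (0 : E) (r / 2),
          (T⁻¹ * ‖u t x‖ ^ 2 + ‖fderiv ℝ (u t) x‖ ^ 2) * Real.exp (-‖x‖ ^ 2 / (4 * t)) ≤
        K * (Real.exp (-r ^ 2 / (500 * t₀)) *
              (∫ t in (0 : ℝ)..T, ∫ x in ball (0 : E) r, (T⁻¹ * ‖u t x‖ ^ 2 + ‖fderiv ℝ (u t) x‖ ^ 2)) +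
            t₀ ^ ((Module.finrank ℝ E : ℝ) / 2) *
              Real.exp (K * (r ^ 2 / t₀) * Real.log (Real.exp 1 * t₀ / t₁)) *
              ∫ x in ball (0 : E) r, ‖u 0 x‖ ^ 2 * (t₁ ^ (-(Module.finrank ℝ E : ℝ) / 2) *
                Real.exp (-‖x‖ ^ 2 / (4 * t₁)))) := by
  obtain ⟨Cψ, hCψ, hcut⟩ := exists_radial_cutoff E
  have hd0 : (0 : ℝ) ≤ (Module.finrank ℝ E : ℝ) := by positivity
  have hd3' : (Module.finrank ℝ E : ℝ) ≤ 3 := by exact_mod_cast hd3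
  obtain ⟨K, hK⟩ : ∃ K : ℝ, K = (99 * (4 * (2 + Cψ ^ 2 + 4 * Cψ)) + 4400 * (6 + Cψ)) * Real.exp 99 +
      11 * Real.exp 3 + 1 := ⟨_, rfl⟩
  have hKa : 99 * (4 * (2 + Cψ ^ 2 + 4 * Cψ)) * Real.exp 99 + 4400 * (6 + Cψ) * Real.exp 99 ≤ K := by
    rw [hK]
    have : 0 ≤ 11 * Real.exp 3 := by positivity
    nlinarith
  have hKc : 11 * Real.exp 3 ≤ K := by
    rw [hK]
    have : 0 ≤ (99 * (4 * (2 + Cψ ^ 2 + 4 * Cψ)) + 4400 * (6 + Cψ)) * Real.exp 99 := by positivity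
    linarith
  have hK80 : 1 / 80 ≤ K := by
    rw [hK]
    have : 0 ≤ (99 * (4 * (2 + Cψ ^ 2 + 4 * Cψ)) + 4400 * (6 + Cψ)) * Real.exp 99 + 11 * Real.exp 3 := by
      positivity
    linarith
  have hKpos : 0 < K := by linarith
  refine ⟨K, hKpos, ?_⟩
  intro T r t₀ t₁ u hT hr hrT ht₁ ht₁₀ ht₀T hu hL
  have ht₀ : 0 < t₀ := lt_of_lt_of_le ht₁ ht₁₀
  obtain ⟨ψ, hψs, hψ1, hψ0, hψnn, hψle, hψt, hψg, hψl, hψin, hψout⟩ := hcut r hr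
  -- pigeonhole
  obtain ⟨φ, hφ⟩ : ∃ φ : ℝ → ℝ, φ = fun t => ∫ x in ball (0 : E) r, (T⁻¹ * ‖u t x‖ ^ 2 + ‖fderiv ℝ (u t) x‖ ^ 2) :=
    ⟨_, rfl⟩
  obtain ⟨cφ, hφ0⟩ := continuousOn_phi hT hu hφ
  have iφ : IntervalIntegrable φ volume 0 T := cφ.intervalIntegrable_of_Icc hT.le
  obtain ⟨T₀, hT₀mem, hT₀φ⟩ := exists_mul_le_intervalIntegral (c := T / 200) (d := T / 100) (by linarith)
    (cφ.mono (Icc_subset_Icc (by positivity) (by linarith)))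
  have hT₀ : 0 < T₀ := lt_of_lt_of_le (by positivity) hT₀mem.1
  have hXsub : ∫ t in T / 200..T / 100, φ t ≤ ∫ t in (0 : ℝ)..T, φ t :=
    intervalIntegral.integral_mono_interval (by positivity) (by linarith) (by linarith)
      (Eventually.of_forall fun t => hφ0 t) iφ
  have hX0 : 0 ≤ ∫ t in (0 : ℝ)..T, φ t := intervalIntegral.integral_nonneg hT.le fun t _ => hφ0 t
  have hφT₀ : φ T₀ ≤ 200 / T * ∫ t in (0 : ℝ)..T, φ t := by
    rw [div_mul_eq_mul_div, le_div_iff₀ hT]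
    have : T / 100 - T / 200 = T / 200 := by ring
    rw [this] at hT₀φ
    nlinarith
  have hφT₀' : ∫ x in ball (0 : E) r, (T⁻¹ * ‖u T₀ x‖ ^ 2 + ‖fderiv ℝ (u T₀) x‖ ^ 2) ≤
      200 / T * ∫ t in (0 : ℝ)..T, ∫ x in ball (0 : E) r, (T⁻¹ * ‖u t x‖ ^ 2 + ‖fderiv ℝ (u t) x‖ ^ 2) := by
    have := hφT₀
    rw [hφ] at this
    exact this
  have main := second_carleman_assembled hd3 hCψ hT hr hrT ht₁ ht₁₀ ht₀T hu hL hψs hψ1 hψ0 hψnn hψle hψt hψg hψl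
    hψin hψout hT₀mem hφT₀'
  -- the coefficients
  have hSpos : 0 < T₀ + t₁ := by positivity
  have hαpos : 0 < r ^ 2 / (400 * t₀) := by positivity
  have hα10 : 10 * T ≤ r ^ 2 / (400 * t₀) * t₀ := by
    rw [div_mul_eq_mul_div, le_div_iff₀ (by positivity)]
    nlinarith
  have hP : (T₀ + t₁) ^ 2 / (t₀ * T) ≤ r ^ 2 / (400 * t₀) := by
    rw [div_le_iff₀ (by positivity)]
    have h1 : (T₀ + t₁) ^ 2 ≤ (T / 50) ^ 2 := pow_le_pow_left₀ hSpos.le (by linarith [hT₀mem.2]) 2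
    nlinarith
  have hQ : (T₀ + t₁) / t₀ ≤ r ^ 2 / (400 * t₀) := by
    rw [div_le_iff₀ ht₀]
    linarith [hT₀mem.2]
  have cA := coef_shell_le (Csh := 4 * (2 + Cψ ^ 2 + 4 * Cψ)) hT hr ht₀ hSpos hd0 hd3' (by positivity) rfl hαpos
    hrT ht₀T hP
  have cB := coef_top_le (Cψ := Cψ) hT ht₀ ht₁.le (rfl : T₀ + t₁ = T₀ + t₁) hSpos hd0 hCψ hαpos hT₀mem.1 ht₀T hP
  have cC := coef_bottom_le ht₀ ht₁ ht₁₀ hSpos hd0 hd3' hαpos hQ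
  -- divide by `c₀` and bound
  set c₀ : ℝ := t₀ / (10 * (T₀ + t₁)) * Real.exp (-((Module.finrank ℝ E : ℝ) / 2) * Real.log (3 * t₀) -
    r ^ 2 / (400 * t₀) * Real.log (3 * t₀ / (T₀ + t₁))) with hc₀
  have hc₀pos : 0 < c₀ := by positivity
  set X : ℝ := ∫ t in (0 : ℝ)..T, ∫ x in ball (0 : E) r, (T⁻¹ * ‖u t x‖ ^ 2 + ‖fderiv ℝ (u t) x‖ ^ 2) with hX
  set Y : ℝ := ∫ x in ball (0 : E) r, ‖u 0 x‖ ^ 2 * (t₁ ^ (-(Module.finrank ℝ E : ℝ) / 2) *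
    Real.exp (-‖x‖ ^ 2 / (4 * t₁))) with hY
  set LHS : ℝ := ∫ t in t₀..2 * t₀, ∫ x in ball (0 : E) (r / 2),
    (T⁻¹ * ‖u t x‖ ^ 2 + ‖fderiv ℝ (u t) x‖ ^ 2) * Real.exp (-‖x‖ ^ 2 / (4 * t)) with hLHS
  have hX0' : 0 ≤ X := by
    have := hX0
    rw [hφ] at this
    exact this
  have hY0 : 0 ≤ Y := setIntegral_nonneg measurableSet_ball fun x _ => by positivity
  -- name the three coefficients
  set A₂ : ℝ := 33 / 10 * (T₀ + t₁) * (4 * (2 + Cψ ^ 2 + 4 * Cψ) *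
    Real.exp ((r ^ 2 / (400 * t₀) + (Module.finrank ℝ E : ℝ) / 2) *
      Real.log ((r ^ 2 / (400 * t₀) + (Module.finrank ℝ E : ℝ) / 2) / (r ^ 2 / 16)) -
      (r ^ 2 / (400 * t₀) + (Module.finrank ℝ E : ℝ) / 2) + r ^ 2 / (400 * t₀) * Real.log (T₀ + t₁) +
      r ^ 2 / (400 * t₀)) * (3 * T⁻¹)) with hA₂
  set B₂ : ℝ := 2 * ((T₀ + t₁) + (T₀ + t₁) ^ 2 / (10 * (T₀ + t₁))) *
    (Real.exp (-((Module.finrank ℝ E : ℝ) / 2) * Real.log (T₀ + t₁) + r ^ 2 / (400 * t₀)) * (6 + Cψ) *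
      (200 / T)) with hB₂
  set C₂ : ℝ := 11 / 10 * (r ^ 2 / (400 * t₀)) * Real.exp (r ^ 2 / (400 * t₀) * Real.log ((T₀ + t₁) / t₁) +
    r ^ 2 / (400 * t₀)) with hC₂
  have hmain : c₀ * LHS ≤ A₂ * X + B₂ * X + C₂ * Y := main
  have hdiv : LHS ≤ c₀⁻¹ * A₂ * X + c₀⁻¹ * B₂ * X + c₀⁻¹ * C₂ * Y := by
    have := mul_le_mul_of_nonneg_left hmain (inv_nonneg.2 hc₀pos.le)
    rw [← mul_assoc, inv_mul_cancel₀ hc₀pos.ne', one_mul] at this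
    linarith
  have hexpα : Real.exp (-(8 / 10) * (r ^ 2 / (400 * t₀))) = Real.exp (-r ^ 2 / (500 * t₀)) := by
    congr 1
    field_simp
    ring
  have hLlog : 0 ≤ Real.log (Real.exp 1 * t₀ / t₁) := by
    refine Real.log_nonneg ?_
    rw [le_div_iff₀ ht₁]
    nlinarith [Real.add_one_le_exp (1 : ℝ)]
  have h5α : 5 * (r ^ 2 / (400 * t₀)) * Real.log (Real.exp 1 * t₀ / t₁) ≤
      K * (r ^ 2 / t₀) * Real.log (Real.exp 1 * t₀ / t₁) := by
    refine mul_le_mul_of_nonneg_right ?_ hLlog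
    have : 5 * (r ^ 2 / (400 * t₀)) = 1 / 80 * (r ^ 2 / t₀) := by
      field_simp
      ring
    rw [this]
    exact mul_le_mul_of_nonneg_right hK80 (by positivity)
  have hfin1 : c₀⁻¹ * A₂ * X + c₀⁻¹ * B₂ * X ≤ K * (Real.exp (-r ^ 2 / (500 * t₀)) * X) := by
    have h1 := mul_le_mul_of_nonneg_right cA hX0'
    have h2 := mul_le_mul_of_nonneg_right cB hX0'
    rw [hexpα] at h1 h2
    have h4 := mul_le_mul_of_nonneg_right hKa (by positivity : (0 : ℝ) ≤ Real.exp (-r ^ 2 / (500 * t₀)) * X)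
    linarith [h1, h2, h4]
  have hfin2 : c₀⁻¹ * C₂ * Y ≤ K * (t₀ ^ ((Module.finrank ℝ E : ℝ) / 2) *
      Real.exp (K * (r ^ 2 / t₀) * Real.log (Real.exp 1 * t₀ / t₁)) * Y) := by
    have h1 : c₀⁻¹ * C₂ ≤ t₀ ^ ((Module.finrank ℝ E : ℝ) / 2) * (11 * Real.exp 3 *
        Real.exp (5 * (r ^ 2 / (400 * t₀)) * Real.log (Real.exp 1 * t₀ / t₁))) := cC
    have h2 : 11 * Real.exp 3 * Real.exp (5 * (r ^ 2 / (400 * t₀)) * Real.log (Real.exp 1 * t₀ / t₁)) ≤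
        K * Real.exp (K * (r ^ 2 / t₀) * Real.log (Real.exp 1 * t₀ / t₁)) :=
      mul_le_mul hKc (Real.exp_le_exp.2 h5α) (Real.exp_pos _).le hKpos.le
    have h3 := mul_le_mul_of_nonneg_left h2 (by positivity : (0 : ℝ) ≤ t₀ ^ ((Module.finrank ℝ E : ℝ) / 2))
    have h4 := mul_le_mul_of_nonneg_right (h1.trans h3) hY0
    refine h4.trans (le_of_eq ?_)
    ring
  calc LHS ≤ c₀⁻¹ * A₂ * X + c₀⁻¹ * B₂ * X + c₀⁻¹ * C₂ * Y := hdiv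
    _ ≤ K * (Real.exp (-r ^ 2 / (500 * t₀)) * X) + K * (t₀ ^ ((Module.finrank ℝ E : ℝ) / 2) *
        Real.exp (K * (r ^ 2 / t₀) * Real.log (Real.exp 1 * t₀ / t₁)) * Y) := by linarith [hfin1, hfin2]
    _ = _ := by ring

end Main

end TaoCarleman

end Literature.Analysis.FluidPDE
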